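import Summits.CriticalPhenomena.PercolationContinuityZ3.Theorems.Transplant.SkelNegBParamsRootValsY
import Summits.CriticalPhenomena.PercolationContinuityZ3.Theorems.Transplant.SkelNegBParamsResiduals2
import Summits.CriticalPhenomena.PercolationContinuityZ3.Theorems.Transplant.SkelNegBParamsRootArithY2
import HarnessLib

/-!
# N1 params, chain of record `NegB`, part RootFineY: THE y′-LEG's LAST CORE AT THE LEDGER — p3's `hLg₁/hLg₂` (vertical `du`: the level reading lands in
# `20r₁ ± (b0T₁ − 1)`) and `hLg₃` (the fine abscissa within `±(b0T₀ − 1)`) of `rootOblTWAt_negBT_y` in LITERAL shape, at `yY := KS.yYof σu σ' yX`,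
# `Ny := KS.NyOf σ' yY`, `qY := KS.qY`, boxes `KS.mbLo/mbHi/maLo/maHi` (part RootValsY), for ANY x-origin `yX` with `4|Λ₀(yX)| ≤ 7m`, `|Λ₁(yX)| ≤ 2m`
# (parts RootCasesT / Residuals2 supply these for the three bridge cases)

builds on p205010 (kernel theorem, internal audit signed; external expert review pending) — nothing in this file uses p205010; NOTHING is claimed about
the node `SamePDropOfSkeletonNeg₁` (OPEN).  Pure instantiation of part RootArithY.
Lane `prim-bschramm-*`, seat `prim-bschramm-stmt` (gen 14); helper file (`--supports stmt-CriticalPhenomena-4575 --as helper`); ledger HOME/prim-bschramm-stmt/NEG-PARAMS.md v0.13.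
[cite: KozmaNitzan2024, §4 p. 28 ((32) at the root), Lemma 11 (p. 22)] [cite: MartineauTassion2017, §4.3 Lemma 4.2]
-/

noncomputable section

open scoped Classical

namespace Summit.CriticalPhenomena.PercolationContinuityZ3.Theorems.Transplant

namespace PlanarSkeletonNeg

namespace NegB

open Literature.Probability.Percolation Literature.Probability.LatticeModels SimpleGraph
open SkelConc (Consts)
open Skelφ (shearUnit shearUnit_pos)
open Skelφ.StepI (DataN)
open TwoAxis.Para (modulus)
open Neg

namespace KS

section AtT

variable (κ : Consts) {V : Type} [DecidableEq V] [Countable V] {G : SimpleGraph V} [G.LocallyFinite] (Φ : PlanarSkeletonNeg G) (t : V)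
  (p : unitInterval) (D : DataN V) (mk : ℕ) (gx fx : Neg.FSlot)

/-- **`hLg₁` of the y′-leg** (`σ' = 1`, vertical `du`): the last core's level reading lies in `[20r₁ − b0T₁ + 1, 20r₁ + b0T₁ − 1]`.
[cite: KozmaNitzan2024, §4 Lemma 11 (p. 22)] -/
theorem hLgY₁_R (hN : EqNumL κ Φ t p D (gT mk gx κ Φ t p D) (fT mk fx κ Φ t p D)) (hκ : (hL κ Φ t p D (gT mk gx κ Φ t p D) (fT mk fx κ Φ t p D)).natAbs ≤ 10 * nL κ Φ t p D (gT mk gx κ Φ t p D) (fT mk fx κ Φ t p D))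
    {σ' : ℤ} (hσ' : σ' = 1 ∨ σ' = -1) (yY : Site 2) (hΛ₁3 : |Λ₁of κ Φ t p D (gT mk gx κ Φ t p D) (fT mk fx κ Φ t p D) yY| ≤ 3 * modulus (nL κ Φ t p D (gT mk gx κ Φ t p D) (fT mk fx κ Φ t p D)) (hL κ Φ t p D (gT mk gx κ Φ t p D) (fT mk fx κ Φ t p D)) (vL κ Φ t p D (gT mk gx κ Φ t p D) (fT mk fx κ Φ t p D)) (Skelφ.NegPrm.vβOf (nL κ Φ t p D (gT mk gx κ Φ t p D) (fT mk fx κ Φ t p D)) (hL κ Φ t p D (gT mk gx κ Φ t p D) (fT mk fx κ Φ t p D)) (ℓL κ Φ t p D (gT mk gx κ Φ t p D) (fT mk fx κ Φ t p D)) (vL κ Φ t p D (gT mk gx κ Φ t p D) (fT mk fx κ Φ t p D)))) (hσ1 : σ' = 1) :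
    20 * ((fcells κ Φ t p D (gT mk gx κ Φ t p D) (fT mk fx κ Φ t p D)).r 1 : ℤ) - (b0T κ Φ t p D (gT mk gx κ Φ t p D) (fT mk fx κ Φ t p D) 1 : ℤ) + 1 ≤ TwoAxis.Para.coarse (20 * ((fcells κ Φ t p D (gT mk gx κ Φ t p D) (fT mk fx κ Φ t p D)).K : ℤ) * (((fcells κ Φ t p D (gT mk gx κ Φ t p D) (fT mk fx κ Φ t p D)).s 1 : ℕ) : ℤ)) (Skelφ.NegPrm.Dof (nL κ Φ t p D (gT mk gx κ Φ t p D) (fT mk fx κ Φ t p D)) (hL κ Φ t p D (gT mk gx κ Φ t p D) (fT mk fx κ Φ t p D)) (ℓL κ Φ t p D (gT mk gx κ Φ t p D) (fT mk fx κ Φ t p D)) (vL κ Φ t p D (gT mk gx κ Φ t p D) (fT mk fx κ Φ t p D)) / 2) (Skelφ.NegPrm.Dof (nL κ Φ t p D (gT mk gx κ Φ t p D) (fT mk fx κ Φ t p D)) (hL κ Φ t p D (gT mk gx κ Φ t p D) (fT mk fx κ Φ t p D)) (ℓL κ Φ t p D (gT mk gx κ Φ t p D) (fT mk fx κ Φ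 t p D)) (vL κ Φ t p D (gT mk gx κ Φ t p D) (fT mk fx κ Φ t p D))) (TwoAxis.Para.lam1 800 (nL κ Φ t p D (gT mk gx κ Φ t p D) (fT mk fx κ Φ t p D) : ℤ) (hL κ Φ t p D (gT mk gx κ Φ t p D) (fT mk fx κ Φ t p D)) yY) + ((20 * ((fcells κ Φ t p D (gT mk gx κ Φ t p D) (fT mk fx κ Φ t p D)).K : ℤ) * (((fcells κ Φ t p D (gT mk gx κ Φ t p D) (fT mk fx κ Φ t p D)).s 1 : ℕ) : ℤ)) * (800 * ((shearUnit (nL κ Φ t p D (gT mk gx κ Φ t p D) (fT mk fx κ Φ t p D)) (hL κ Φ t p D (gT mk gx κ Φ t p D) (fT mk fx κ Φ t p D)) : ℤ) * (min (σ' * (mbLo κ Φ t p D (gT mk gx κ Φ t p D) (fT mk fx κ Φ t p D) mk (qY κ Φ t p D (gT mk gx κ Φ t p D) (fT mk fx κ Φ t p D) mk) (NyOf κ Φ t p D (gT mk gx κ Φ t p D) (fT mk fx κ Φ t p D) σ' yY))) (σ' * (mbHi κ Φ t p D (gT mk gx κ Φ t p D) (fT mk fx κ Φ t p D) mk (qY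 κ Φ t p D (gT mk gx κ Φ t p D) (fT mk fx κ Φ t p D) mk) (NyOf κ Φ t p D (gT mk gx κ Φ t p D) (fT mk fx κ Φ t p D) σ' yY))) - 1)))) / (Skelφ.NegPrm.Dof (nL κ Φ t p D (gT mk gx κ Φ t p D) (fT mk fx κ Φ t p D)) (hL κ Φ t p D (gT mk gx κ Φ t p D) (fT mk fx κ Φ t p D)) (ℓL κ Φ t p D (gT mk gx κ Φ t p D) (fT mk fx κ Φ t p D)) (vL κ Φ t p D (gT mk gx κ Φ t p D) (fT mk fx κ Φ t p D))) ∧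
      TwoAxis.Para.coarse (20 * ((fcells κ Φ t p D (gT mk gx κ Φ t p D) (fT mk fx κ Φ t p D)).K : ℤ) * (((fcells κ Φ t p D (gT mk gx κ Φ t p D) (fT mk fx κ Φ t p D)).s 1 : ℕ) : ℤ)) (Skelφ.NegPrm.Dof (nL κ Φ t p D (gT mk gx κ Φ t p D) (fT mk fx κ Φ t p D)) (hL κ Φ t p D (gT mk gx κ Φ t p D) (fT mk fx κ Φ t p D)) (ℓL κ Φ t p D (gT mk gx κ Φ t p D) (fT mk fx κ Φ t p D)) (vL κ Φ t p D (gT mk gx κ Φ t p D) (fT mk fx κ Φ t p D)) / 2) (Skelφ.NegPrm.Dof (nL κ Φ t p D (gT mk gx κ Φ t p D) (fT mk fx κ Φ t p D)) (hL κ Φ t p D (gT mk gx κ Φ t p D) (fT mk fx κ Φ t p D)) (ℓL κ Φ t p D (gT mk gx κ Φ t p D) (fT mk fx κ Φ t p D)) (vL κ Φ t p D (gT mk gx κ Φ t p D) (fT mk fx κ Φ t p D))) (TwoAxis.Para.lam1 800 (nL κ Φ t p D (gT mk gx κ Φ t p D) (fT mk fx κ Φ t p D) : ℤ) (hL κ Φ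 t p D (gT mk gx κ Φ t p D) (fT mk fx κ Φ t p D)) yY) +
        ((20 * ((fcells κ Φ t p D (gT mk gx κ Φ t p D) (fT mk fx κ Φ t p D)).K : ℤ) * (((fcells κ Φ t p D (gT mk gx κ Φ t p D) (fT mk fx κ Φ t p D)).s 1 : ℕ) : ℤ)) * (800 * ((shearUnit (nL κ Φ t p D (gT mk gx κ Φ t p D) (fT mk fx κ Φ t p D)) (hL κ Φ t p D (gT mk gx κ Φ t p D) (fT mk fx κ Φ t p D)) : ℤ) * (max (σ' * (mbLo κ Φ t p D (gT mk gx κ Φ t p D) (fT mk fx κ Φ t p D) mk (qY κ Φ t p D (gT mk gx κ Φ t p D) (fT mk fx κ Φ t p D) mk) (NyOf κ Φ t p D (gT mk gx κ Φ t p D) (fT mk fx κ Φ t p D) σ' yY))) (σ' * (mbHi κ Φ t p D (gT mk gx κ Φ t p D) (fT mk fx κ Φ t p D) mk (qY κ Φ t p D (gT mk gx κ Φ t p D) (fT mk fx κ Φ t p D) mk) (NyOf κ Φ t p D (gT mk gx κ Φ t p D) (fT mk fx κ Φ t p D) σ' yY)))) + (shearUnit (nL κ Φ t p D (gT mk gx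 κ Φ t p D) (fT mk fx κ Φ t p D)) (hL κ Φ t p D (gT mk gx κ Φ t p D) (fT mk fx κ Φ t p D)) : ℤ) - 1))) / (Skelφ.NegPrm.Dof (nL κ Φ t p D (gT mk gx κ Φ t p D) (fT mk fx κ Φ t p D)) (hL κ Φ t p D (gT mk gx κ Φ t p D) (fT mk fx κ Φ t p D)) (ℓL κ Φ t p D (gT mk gx κ Φ t p D) (fT mk fx κ Φ t p D)) (vL κ Φ t p D (gT mk gx κ Φ t p D) (fT mk fx κ Φ t p D))) + 1 ≤ 20 * ((fcells κ Φ t p D (gT mk gx κ Φ t p D) (fT mk fx κ Φ t p D)).r 1 : ℤ) + (b0T κ Φ t p D (gT mk gx κ Φ t p D) (fT mk fx κ Φ t p D) 1 : ℤ) - 1 := by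
  obtain ⟨hn1, hℓ1⟩ := one_le_of_eqNumL κ Φ t p D _ _ hN
  have hm0 := (Skelφ.NegPrm.modulus_vβOf hn1 (hL κ Φ t p D (gT mk gx κ Φ t p D) (fT mk fx κ Φ t p D)) (ℓL κ Φ t p D (gT mk gx κ Φ t p D) (fT mk fx κ Φ t p D)) (vL κ Φ t p D (gT mk gx κ Φ t p D) (fT mk fx κ Φ t p D))).1
  have hmℓ := (Skelφ.NegPrm.modulus_vβOf hn1 (hL κ Φ t p D (gT mk gx κ Φ t p D) (fT mk fx κ Φ t p D)) (ℓL κ Φ t p D (gT mk gx κ Φ t p D) (fT mk fx κ Φ t p D)) (vL κ Φ t p D (gT mk gx κ Φ t p D) (fT mk fx κ Φ t p D))).2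
  have hm : (nL κ Φ t p D (gT mk gx κ Φ t p D) (fT mk fx κ Φ t p D) : ℤ) * ((ℓL κ Φ t p D (gT mk gx κ Φ t p D) (fT mk fx κ Φ t p D) : ℤ) - 1) < modulus (nL κ Φ t p D (gT mk gx κ Φ t p D) (fT mk fx κ Φ t p D)) (hL κ Φ t p D (gT mk gx κ Φ t p D) (fT mk fx κ Φ t p D)) (vL κ Φ t p D (gT mk gx κ Φ t p D) (fT mk fx κ Φ t p D)) (Skelφ.NegPrm.vβOf (nL κ Φ t p D (gT mk gx κ Φ t p D) (fT mk fx κ Φ t p D)) (hL κ Φ t p D (gT mk gx κ Φ t p D) (fT mk fx κ Φ t p D)) (ℓL κ Φ t p D (gT mk gx κ Φ t p D) (fT mk fx κ Φ t p D)) (vL κ Φ t p D (gT mk gx κ Φ t p D) (fT mk fx κ Φ t p D))) := by linarith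
  obtain ⟨hc0, hc1, hr0, hr1, hb0, hb1, hu0, hu1⟩ := units_eq κ Φ t p D (gT mk gx κ Φ t p D) (fT mk fx κ Φ t p D)
  have hv : |(vL κ Φ t p D (gT mk gx κ Φ t p D) (fT mk fx κ Φ t p D))| ≤ (nL κ Φ t p D (gT mk gx κ Φ t p D) (fT mk fx κ Φ t p D) : ℤ) := hN.v_le
  have hn : (1 : ℤ) ≤ (nL κ Φ t p D (gT mk gx κ Φ t p D) (fT mk fx κ Φ t p D) : ℤ) := by exact_mod_cast hn1
  have h10 : ((((hL κ Φ t p D (gT mk gx κ Φ t p D) (fT mk fx κ Φ t p D))).natAbs : ℤ)) ≤ 10 * (nL κ Φ t p D (gT mk gx κ Φ t p D) (fT mk fx κ Φ t p D) : ℤ) := by exact_mod_cast hκ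
  have h0' : (0 : ℤ) ≤ ((((hL κ Φ t p D (gT mk gx κ Φ t p D) (fT mk fx κ Φ t p D))).natAbs : ℤ)) := Nat.cast_nonneg _
  have hU : (nL κ Φ t p D (gT mk gx κ Φ t p D) (fT mk fx κ Φ t p D) : ℤ) ≤ (shearUnit (nL κ Φ t p D (gT mk gx κ Φ t p D) (fT mk fx κ Φ t p D)) (hL κ Φ t p D (gT mk gx κ Φ t p D) (fT mk fx κ Φ t p D)) : ℤ) ∧ (shearUnit (nL κ Φ t p D (gT mk gx κ Φ t p D) (fT mk fx κ Φ t p D)) (hL κ Φ t p D (gT mk gx κ Φ t p D) (fT mk fx κ Φ t p D)) : ℤ) ≤ 11 * (nL κ Φ t p D (gT mk gx κ Φ t p D) (fT mk fx κ Φ t p D) : ℤ) := by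
    unfold Skelφ.shearUnit; simp only [Nat.cast_add]; constructor <;> linarith
  have hRA : (0 : ℤ) ≤ (RA' κ Φ t p D mk : ℤ) := Nat.cast_nonneg _
  have hRAn : 2000 * ((RA' κ Φ t p D mk : ℤ) + 2) ≤ (nL κ Φ t p D (gT mk gx κ Φ t p D) (fT mk fx κ Φ t p D) : ℤ) := by
    have := (nL_floorsT κ Φ t p D mk fx (gT mk gx κ Φ t p D)).2.1; exact_mod_cast this
  have hRAℓ : 22000 * ((RA' κ Φ t p D mk : ℤ) + 2) ≤ (ℓL κ Φ t p D (gT mk gx κ Φ t p D) (fT mk fx κ Φ t p D) : ℤ) := by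
    have h1 : ((22000 * (RA' κ Φ t p D mk + 2) : ℕ) : ℤ) ≤ (ML κ Φ t p D (gT mk gx κ Φ t p D) : ℤ) := by exact_mod_cast (ML_floorsT κ Φ t p D mk gx).2.1
    have h2 := hN.ℓ_le
    push_cast at h1; linarith
  have hℓ44 : (44000 : ℤ) ≤ (ℓL κ Φ t p D (gT mk gx κ Φ t p D) (fT mk fx κ Φ t p D) : ℤ) := by linarith
  obtain ⟨sL, sH, sH', sLa⟩ := sY_spec κ Φ t p D (gT mk gx κ Φ t p D) (fT mk fx κ Φ t p D) hn1
  have hUqY : (shearUnit (nL κ Φ t p D (gT mk gx κ Φ t p D) (fT mk fx κ Φ t p D)) (hL κ Φ t p D (gT mk gx κ Φ t p D) (fT mk fx κ Φ t p D)) : ℤ) * ((qY κ Φ t p D (gT mk gx κ Φ t p D) (fT mk fx κ Φ t p D) mk) : ℤ) ≤ (nL κ Φ t p D (gT mk gx κ Φ t p D) (fT mk fx κ Φ t p D) : ℤ) * (ℓL κ Φ t p D (gT mk gx κ Φ t p D) (fT mk fx κ Φ t p D) : ℤ) + (shearUnit (nL κ Φ t p D (gT mk gx κ Φ t p D) (fT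 mk fx κ Φ t p D)) (hL κ Φ t p D (gT mk gx κ Φ t p D) (fT mk fx κ Φ t p D)) : ℤ) * (4 * (RA' κ Φ t p D mk : ℤ) + 4) := by
    unfold qY; push_cast
    have hW := (Wrun_spec κ Φ t p D (gT mk gx κ Φ t p D) (fT mk fx κ Φ t p D) hn1).1
    nlinarith [hU.1]
  have hmpos : 0 < modulus (nL κ Φ t p D (gT mk gx κ Φ t p D) (fT mk fx κ Φ t p D)) (hL κ Φ t p D (gT mk gx κ Φ t p D) (fT mk fx κ Φ t p D)) (vL κ Φ t p D (gT mk gx κ Φ t p D) (fT mk fx κ Φ t p D)) (Skelφ.NegPrm.vβOf (nL κ Φ t p D (gT mk gx κ Φ t p D) (fT mk fx κ Φ t p D)) (hL κ Φ t p D (gT mk gx κ Φ t p D) (fT mk fx κ Φ t p D)) (ℓL κ Φ t p D (gT mk gx κ Φ t p D) (fT mk fx κ Φ t p D)) (vL κ Φ t p D (gT mk gx κ Φ t p D) (fT mk fx κ Φ t p D))) := by linarith [mul_nonneg (show (0:ℤ) ≤ (nL κ Φ t p D (gT mk gx κ Φ t p D) (fT mk fx κ Φ t p D) : ℤ) by linarith)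 (show (0:ℤ) ≤ (ℓL κ Φ t p D (gT mk gx κ Φ t p D) (fT mk fx κ Φ t p D) : ℤ) - 1 by linarith)]
  obtain ⟨hN', hcen⟩ := NyOf_spec κ Φ t p D (gT mk gx κ Φ t p D) (fT mk fx κ Φ t p D) hN hσ' yY hΛ₁3
  -- the last core's level window: `U·mbLo − U ≥ (Ny+1)m − rβ`, `U·mbHi + U − 1 ≤ (Ny+1)m + rβ`, `rβ ≤ 2m + 3n`
  have hN0 : (0 : ℤ) ≤ ((NyOf κ Φ t p D (gT mk gx κ Φ t p D) (fT mk fx κ Φ t p D) σ' yY) : ℤ) := Nat.cast_nonneg _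
  have hUpos : (0:ℤ) < (shearUnit (nL κ Φ t p D (gT mk gx κ Φ t p D) (fT mk fx κ Φ t p D)) (hL κ Φ t p D (gT mk gx κ Φ t p D) (fT mk fx κ Φ t p D)) : ℤ) := by linarith
  have sL' : (shearUnit (nL κ Φ t p D (gT mk gx κ Φ t p D) (fT mk fx κ Φ t p D)) (hL κ Φ t p D (gT mk gx κ Φ t p D) (fT mk fx κ Φ t p D)) : ℤ) * sLoY κ Φ t p D (gT mk gx κ Φ t p D) (fT mk fx κ Φ t p D) ≤ (nL κ Φ t p D (gT mk gx κ Φ t p D) (fT mk fx κ Φ t p D) : ℤ) * (ℓL κ Φ t p D (gT mk gx κ Φ t p D) (fT mk fx κ Φ t p D) : ℤ) - (shearUnit (nL κ Φ t p D (gT mk gx κ Φ t p D) (fT mk fx κ Φ t p D)) (hL κ Φ t p D (gT mk gx κ Φ t p D) (fT mk fx κ Φ t p D)) : ℤ) + 1 := by unfold sLoY; exact Int.mul_ediv_self_le hUpos.ne'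
  have hbL : (((NyOf κ Φ t p D (gT mk gx κ Φ t p D) (fT mk fx κ Φ t p D) σ' yY) : ℤ) + 1) * modulus (nL κ Φ t p D (gT mk gx κ Φ t p D) (fT mk fx κ Φ t p D)) (hL κ Φ t p D (gT mk gx κ Φ t p D) (fT mk fx κ Φ t p D)) (vL κ Φ t p D (gT mk gx κ Φ t p D) (fT mk fx κ Φ t p D)) (Skelφ.NegPrm.vβOf (nL κ Φ t p D (gT mk gx κ Φ t p D) (fT mk fx κ Φ t p D)) (hL κ Φ t p D (gT mk gx κ Φ t p D) (fT mk fx κ Φ t p D)) (ℓL κ Φ t p D (gT mk gx κ Φ t p D) (fT mk fx κ Φ t p D)) (vL κ Φ t p D (gT mk gx κ Φ t p D) (fT mk fx κ Φ t p D))) - ((((NyOf κ Φ t p D (gT mk gx κ Φ t p D) (fT mk fx κ Φ t p D) σ' yY) : ℤ) + 1) * ((nL κ Φ t p D (gT mk gx κ Φ t p D) (fT mk fx κ Φ t p D) : ℤ) + 2 * (shearUnit (nL κ Φ t p D (gT mk gx κ Φ t p D) (fT mk fx κ Φ t p D)) (hL κ Φ t p D (gT mk gx κ Φ t p D) (fT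 mk fx κ Φ t p D)) : ℤ)) + (shearUnit (nL κ Φ t p D (gT mk gx κ Φ t p D) (fT mk fx κ Φ t p D)) (hL κ Φ t p D (gT mk gx κ Φ t p D) (fT mk fx κ Φ t p D)) : ℤ) * ((qY κ Φ t p D (gT mk gx κ Φ t p D) (fT mk fx κ Φ t p D) mk) : ℤ) + (((NyOf κ Φ t p D (gT mk gx κ Φ t p D) (fT mk fx κ Φ t p D) σ' yY) : ℤ) + 1) * ((shearUnit (nL κ Φ t p D (gT mk gx κ Φ t p D) (fT mk fx κ Φ t p D)) (hL κ Φ t p D (gT mk gx κ Φ t p D) (fT mk fx κ Φ t p D)) : ℤ) * (RA' κ Φ t p D mk : ℤ)) + (shearUnit (nL κ Φ t p D (gT mk gx κ Φ t p D) (fT mk fx κ Φ t p D)) (hL κ Φ t p D (gT mk gx κ Φ t p D) (fT mk fx κ Φ t p D)) : ℤ)) ≤ (shearUnit (nL κ Φ t p D (gT mk gx κ Φ t p D) (fT mk fx κ Φ t p D)) (hL κ Φ t p D (gT mk gx κ Φ t p D) (fT mk fx κ Φ t p D)) : ℤ) * mbLo κ Φ t p D (gT mk gx κ Φ t p D) (fT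 mk fx κ Φ t p D) mk (qY κ Φ t p D (gT mk gx κ Φ t p D) (fT mk fx κ Φ t p D) mk) (NyOf κ Φ t p D (gT mk gx κ Φ t p D) (fT mk fx κ Φ t p D) σ' yY) - (shearUnit (nL κ Φ t p D (gT mk gx κ Φ t p D) (fT mk fx κ Φ t p D)) (hL κ Φ t p D (gT mk gx κ Φ t p D) (fT mk fx κ Φ t p D)) : ℤ) := by
    unfold mbLo
    have e1 := mul_le_mul_of_nonneg_left sL (by linarith : (0:ℤ) ≤ ((NyOf κ Φ t p D (gT mk gx κ Φ t p D) (fT mk fx κ Φ t p D) σ' yY) : ℤ) + 1)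
    have e2 := mul_le_mul_of_nonneg_left hmℓ (by linarith : (0:ℤ) ≤ ((NyOf κ Φ t p D (gT mk gx κ Φ t p D) (fT mk fx κ Φ t p D) σ' yY) : ℤ) + 1)
    have e3 : (0:ℤ) ≤ (((NyOf κ Φ t p D (gT mk gx κ Φ t p D) (fT mk fx κ Φ t p D) σ' yY) : ℤ) + 1) * (nL κ Φ t p D (gT mk gx κ Φ t p D) (fT mk fx κ Φ t p D) : ℤ) := mul_nonneg (by linarith) (by linarith)
    linarith
  have hbH : (shearUnit (nL κ Φ t p D (gT mk gx κ Φ t p D) (fT mk fx κ Φ t p D)) (hL κ Φ t p D (gT mk gx κ Φ t p D) (fT mk fx κ Φ t p D)) : ℤ) * mbHi κ Φ t p D (gT mk gx κ Φ t p D) (fT mk fx κ Φ t p D) mk (qY κ Φ t p D (gT mk gx κ Φ t p D) (fT mk fx κ Φ t p D) mk) (NyOf κ Φ t p D (gT mk gx κ Φ t p D) (fT mk fx κ Φ t p D) σ' yY) + (shearUnit (nL κ Φ t p D (gT mk gx κ Φ t p D) (fT mk fx κ Φ t p D)) (hL κ Φ t p D (gT mk gx κ Φ t p D) (fT mk fx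 κ Φ t p D)) : ℤ) - 1 ≤ (((NyOf κ Φ t p D (gT mk gx κ Φ t p D) (fT mk fx κ Φ t p D) σ' yY) : ℤ) + 1) * modulus (nL κ Φ t p D (gT mk gx κ Φ t p D) (fT mk fx κ Φ t p D)) (hL κ Φ t p D (gT mk gx κ Φ t p D) (fT mk fx κ Φ t p D)) (vL κ Φ t p D (gT mk gx κ Φ t p D) (fT mk fx κ Φ t p D)) (Skelφ.NegPrm.vβOf (nL κ Φ t p D (gT mk gx κ Φ t p D) (fT mk fx κ Φ t p D)) (hL κ Φ t p D (gT mk gx κ Φ t p D) (fT mk fx κ Φ t p D)) (ℓL κ Φ t p D (gT mk gx κ Φ t p D) (fT mk fx κ Φ t p D)) (vL κ Φ t p D (gT mk gx κ Φ t p D) (fT mk fx κ Φ t p D))) + ((((NyOf κ Φ t p D (gT mk gx κ Φ t p D) (fT mk fx κ Φ t p D) σ' yY) : ℤ) + 1) * ((nL κ Φ t p D (gT mk gx κ Φ t p D) (fT mk fx κ Φ t p D) : ℤ) + 2 * (shearUnit (nL κ Φ t p D (gT mk gx κ Φ t p D) (fT mk fx κ Φ t p D)) (hL κ Φ t p D (gT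 mk gx κ Φ t p D) (fT mk fx κ Φ t p D)) : ℤ)) + (shearUnit (nL κ Φ t p D (gT mk gx κ Φ t p D) (fT mk fx κ Φ t p D)) (hL κ Φ t p D (gT mk gx κ Φ t p D) (fT mk fx κ Φ t p D)) : ℤ) * ((qY κ Φ t p D (gT mk gx κ Φ t p D) (fT mk fx κ Φ t p D) mk) : ℤ) + (((NyOf κ Φ t p D (gT mk gx κ Φ t p D) (fT mk fx κ Φ t p D) σ' yY) : ℤ) + 1) * ((shearUnit (nL κ Φ t p D (gT mk gx κ Φ t p D) (fT mk fx κ Φ t p D)) (hL κ Φ t p D (gT mk gx κ Φ t p D) (fT mk fx κ Φ t p D)) : ℤ) * (RA' κ Φ t p D mk : ℤ)) + (shearUnit (nL κ Φ t p D (gT mk gx κ Φ t p D) (fT mk fx κ Φ t p D)) (hL κ Φ t p D (gT mk gx κ Φ t p D) (fT mk fx κ Φ t p D)) : ℤ)) := by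
    unfold mbHi
    have e1 := mul_le_mul_of_nonneg_left sH (by linarith : (0:ℤ) ≤ ((NyOf κ Φ t p D (gT mk gx κ Φ t p D) (fT mk fx κ Φ t p D) σ' yY) : ℤ) + 1)
    have e2 := mul_le_mul_of_nonneg_left (show (nL κ Φ t p D (gT mk gx κ Φ t p D) (fT mk fx κ Φ t p D) : ℤ) * (ℓL κ Φ t p D (gT mk gx κ Φ t p D) (fT mk fx κ Φ t p D) : ℤ) ≤ modulus (nL κ Φ t p D (gT mk gx κ Φ t p D) (fT mk fx κ Φ t p D)) (hL κ Φ t p D (gT mk gx κ Φ t p D) (fT mk fx κ Φ t p D)) (vL κ Φ t p D (gT mk gx κ Φ t p D) (fT mk fx κ Φ t p D)) (Skelφ.NegPrm.vβOf (nL κ Φ t p D (gT mk gx κ Φ t p D) (fT mk fx κ Φ t p D)) (hL κ Φ t p D (gT mk gx κ Φ t p D) (fT mk fx κ Φ t p D)) (ℓL κ Φ t p D (gT mk gx κ Φ t p D) (fT mk fx κ Φ t p D)) (vL κ Φ t p D (gT mk gx κ Φ t p D) (fT mk fx κ Φ t p D))) + (nL κ Φ t p D (gT mk gx κ Φ t p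 D) (fT mk fx κ Φ t p D) : ℤ) by linarith) (by linarith : (0:ℤ) ≤ ((NyOf κ Φ t p D (gT mk gx κ Φ t p D) (fT mk fx κ Φ t p D) σ' yY) : ℤ) + 1)
    have e3 : (0:ℤ) ≤ (((NyOf κ Φ t p D (gT mk gx κ Φ t p D) (fT mk fx κ Φ t p D) σ' yY) : ℤ) + 1) * (shearUnit (nL κ Φ t p D (gT mk gx κ Φ t p D) (fT mk fx κ Φ t p D)) (hL κ Φ t p D (gT mk gx κ Φ t p D) (fT mk fx κ Φ t p D)) : ℤ) := mul_nonneg (by linarith) hUpos.le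
    linarith
  have hbLH : mbLo κ Φ t p D (gT mk gx κ Φ t p D) (fT mk fx κ Φ t p D) mk (qY κ Φ t p D (gT mk gx κ Φ t p D) (fT mk fx κ Φ t p D) mk) (NyOf κ Φ t p D (gT mk gx κ Φ t p D) (fT mk fx κ Φ t p D) σ' yY) ≤ mbHi κ Φ t p D (gT mk gx κ Φ t p D) (fT mk fx κ Φ t p D) mk (qY κ Φ t p D (gT mk gx κ Φ t p D) (fT mk fx κ Φ t p D) mk) (NyOf κ Φ t p D (gT mk gx κ Φ t p D) (fT mk fx κ Φ t p D) σ' yY) := by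
    unfold mbLo mbHi
    have hss : sLoY κ Φ t p D (gT mk gx κ Φ t p D) (fT mk fx κ Φ t p D) < sHiY κ Φ t p D (gT mk gx κ Φ t p D) (fT mk fx κ Φ t p D) := by
      by_contra hc; push Not at hc
      have := mul_le_mul_of_nonneg_left hc hUpos.le
      linarith
    have e3 : (0:ℤ) ≤ (((NyOf κ Φ t p D (gT mk gx κ Φ t p D) (fT mk fx κ Φ t p D) σ' yY) : ℤ) + 1) * (RA' κ Φ t p D mk : ℤ) := mul_nonneg (by linarith) hRA
    have e4 := mul_le_mul_of_nonneg_left hss.le (by linarith : (0:ℤ) ≤ ((NyOf κ Φ t p D (gT mk gx κ Φ t p D) (fT mk fx κ Φ t p D) σ' yY) : ℤ) + 1)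
    have hq0 : (0:ℤ) ≤ ((qY κ Φ t p D (gT mk gx κ Φ t p D) (fT mk fx κ Φ t p D) mk) : ℤ) := Nat.cast_nonneg _
    linarith
  have hrβ' : ((((NyOf κ Φ t p D (gT mk gx κ Φ t p D) (fT mk fx κ Φ t p D) σ' yY) : ℤ) + 1) * ((nL κ Φ t p D (gT mk gx κ Φ t p D) (fT mk fx κ Φ t p D) : ℤ) + 2 * (shearUnit (nL κ Φ t p D (gT mk gx κ Φ t p D) (fT mk fx κ Φ t p D)) (hL κ Φ t p D (gT mk gx κ Φ t p D) (fT mk fx κ Φ t p D)) : ℤ)) + (shearUnit (nL κ Φ t p D (gT mk gx κ Φ t p D) (fT mk fx κ Φ t p D)) (hL κ Φ t p D (gT mk gx κ Φ t p D) (fT mk fx κ Φ t p D)) : ℤ) * ((qY κ Φ t p D (gT mk gx κ Φ t p D) (fT mk fx κ Φ t p D) mk) : ℤ) + (((NyOf κ Φ t p D (gT mk gx κ Φ t p D) (fT mk fx κ Φ t p D) σ' yY) : ℤ) + 1) * ((shearUnit (nL κ Φ t p D (gT mk gx κ Φ t p D) (fT mk fx κ Φ t p D)) (hL κ Φ t p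 D (gT mk gx κ Φ t p D) (fT mk fx κ Φ t p D)) : ℤ) * (RA' κ Φ t p D mk : ℤ)) + (shearUnit (nL κ Φ t p D (gT mk gx κ Φ t p D) (fT mk fx κ Φ t p D)) (hL κ Φ t p D (gT mk gx κ Φ t p D) (fT mk fx κ Φ t p D)) : ℤ)) ≤ 2 * modulus (nL κ Φ t p D (gT mk gx κ Φ t p D) (fT mk fx κ Φ t p D)) (hL κ Φ t p D (gT mk gx κ Φ t p D) (fT mk fx κ Φ t p D)) (vL κ Φ t p D (gT mk gx κ Φ t p D) (fT mk fx κ Φ t p D)) (Skelφ.NegPrm.vβOf (nL κ Φ t p D (gT mk gx κ Φ t p D) (fT mk fx κ Φ t p D)) (hL κ Φ t p D (gT mk gx κ Φ t p D) (fT mk fx κ Φ t p D)) (ℓL κ Φ t p D (gT mk gx κ Φ t p D) (fT mk fx κ Φ t p D)) (vL κ Φ t p D (gT mk gx κ Φ t p D) (fT mk fx κ Φ t p D))) + 3 * (nL κ Φ t p D (gT mk gx κ Φ t p D) (fT mk fx κ Φ t p D) : ℤ) := by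
    have hN1 : ((NyOf κ Φ t p D (gT mk gx κ Φ t p D) (fT mk fx κ Φ t p D) σ' yY) : ℤ) + 1 ≤ 1000 := by
      have h' : ((0 + 1 + 3 + 1 + NyOf κ Φ t p D (gT mk gx κ Φ t p D) (fT mk fx κ Φ t p D) σ' yY : ℕ) : ℤ) ≤ 1000 := by exact_mod_cast hN'
      push_cast at h'; linarith
    have t1 : (((NyOf κ Φ t p D (gT mk gx κ Φ t p D) (fT mk fx κ Φ t p D) σ' yY) : ℤ) + 1) * ((nL κ Φ t p D (gT mk gx κ Φ t p D) (fT mk fx κ Φ t p D) : ℤ) + 2 * (shearUnit (nL κ Φ t p D (gT mk gx κ Φ t p D) (fT mk fx κ Φ t p D)) (hL κ Φ t p D (gT mk gx κ Φ t p D) (fT mk fx κ Φ t p D)) : ℤ)) ≤ 1000 * (23 * (nL κ Φ t p D (gT mk gx κ Φ t p D) (fT mk fx κ Φ t p D) : ℤ)) := mul_le_mul hN1 (by linarith [hU.2]) (by linarith [hU.1]) (by norm_num)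
    have t2 : (((NyOf κ Φ t p D (gT mk gx κ Φ t p D) (fT mk fx κ Φ t p D) σ' yY) : ℤ) + 1) * ((shearUnit (nL κ Φ t p D (gT mk gx κ Φ t p D) (fT mk fx κ Φ t p D)) (hL κ Φ t p D (gT mk gx κ Φ t p D) (fT mk fx κ Φ t p D)) : ℤ) * (RA' κ Φ t p D mk : ℤ)) ≤ 1000 * (11 * (nL κ Φ t p D (gT mk gx κ Φ t p D) (fT mk fx κ Φ t p D) : ℤ) * (RA' κ Φ t p D mk : ℤ)) :=
      mul_le_mul hN1 (mul_le_mul_of_nonneg_right hU.2 hRA) (mul_nonneg hUpos.le hRA) (by norm_num)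
    have t3 : (shearUnit (nL κ Φ t p D (gT mk gx κ Φ t p D) (fT mk fx κ Φ t p D)) (hL κ Φ t p D (gT mk gx κ Φ t p D) (fT mk fx κ Φ t p D)) : ℤ) * (4 * (RA' κ Φ t p D mk : ℤ) + 4) ≤ 11 * (nL κ Φ t p D (gT mk gx κ Φ t p D) (fT mk fx κ Φ t p D) : ℤ) * (4 * (RA' κ Φ t p D mk : ℤ) + 4) := mul_le_mul_of_nonneg_right hU.2 (by linarith)
    have t4 : (nL κ Φ t p D (gT mk gx κ Φ t p D) (fT mk fx κ Φ t p D) : ℤ) * (22000 * ((RA' κ Φ t p D mk : ℤ) + 2)) ≤ (nL κ Φ t p D (gT mk gx κ Φ t p D) (fT mk fx κ Φ t p D) : ℤ) * (ℓL κ Φ t p D (gT mk gx κ Φ t p D) (fT mk fx κ Φ t p D) : ℤ) := mul_le_mul_of_nonneg_left hRAℓ (by linarith)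
    have t5 : (0:ℤ) ≤ (nL κ Φ t p D (gT mk gx κ Φ t p D) (fT mk fx κ Φ t p D) : ℤ) * (RA' κ Φ t p D mk : ℤ) := mul_nonneg (by linarith) hRA
    linarith [hU.2]
  have ec : F1c κ Φ t p D (gT mk gx κ Φ t p D) (fT mk fx κ Φ t p D) yY + σ' * u₁ κ Φ t p D (gT mk gx κ Φ t p D) (fT mk fx κ Φ t p D) * (((NyOf κ Φ t p D (gT mk gx κ Φ t p D) (fT mk fx κ Φ t p D) σ' yY) : ℤ) + 1) - σ' * 800 * u₁ κ Φ t p D (gT mk gx κ Φ t p D) (fT mk fx κ Φ t p D) = F1c κ Φ t p D (gT mk gx κ Φ t p D) (fT mk fx κ Φ t p D) yY + u₁ κ Φ t p D (gT mk gx κ Φ t p D) (fT mk fx κ Φ t p D) * (((NyOf κ Φ t p D (gT mk gx κ Φ t p D) (fT mk fx κ Φ t p D) σ' yY) : ℤ) + 1) - 800 * u₁ κ Φ t p D (gT mk gx κ Φ t p D) (fT mk fx κ Φ t p D) := by rw [hσ1]; ring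
  rw [ec, F1c_eq] at hcen
  unfold TwoAxis.Para.coarse
  rw [hc1, Dof_eq', (lam_eq κ Φ t p D (gT mk gx κ Φ t p D) (fT mk fx κ Φ t p D) yY).2]
  have e1 : 20 * ((fcells κ Φ t p D (gT mk gx κ Φ t p D) (fT mk fx κ Φ t p D)).r 1 : ℤ) - (b0T κ Φ t p D (gT mk gx κ Φ t p D) (fT mk fx κ Φ t p D) 1 : ℤ) + 1 = 800 * u₁ κ Φ t p D (gT mk gx κ Φ t p D) (fT mk fx κ Φ t p D) - 10 * u₁ κ Φ t p D (gT mk gx κ Φ t p D) (fT mk fx κ Φ t p D) + 1 := by rw [hr1, hb1]; ring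
  have e2 : 20 * ((fcells κ Φ t p D (gT mk gx κ Φ t p D) (fT mk fx κ Φ t p D)).r 1 : ℤ) + (b0T κ Φ t p D (gT mk gx κ Φ t p D) (fT mk fx κ Φ t p D) 1 : ℤ) - 1 = 800 * u₁ κ Φ t p D (gT mk gx κ Φ t p D) (fT mk fx κ Φ t p D) + 10 * u₁ κ Φ t p D (gT mk gx κ Φ t p D) (fT mk fx κ Φ t p D) - 1 := by rw [hr1, hb1]; ring
  rw [e1, e2]
  exact RootArith.alongY_pos (u := u₁ κ Φ t p D (gT mk gx κ Φ t p D) (fT mk fx κ Φ t p D)) (Λ := Λ₁of κ Φ t p D (gT mk gx κ Φ t p D) (fT mk fx κ Φ t p D) yY) hu1 hn hm hU.1 hU.2 hℓ44 hσ1 hbL hbLH hbH hrβ' hcen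

/-- **`hLg₂` of the y′-leg** (`σ' = −1`). [cite: KozmaNitzan2024, §4 Lemma 11 (p. 22)] -/
theorem hLgY₂_R (hN : EqNumL κ Φ t p D (gT mk gx κ Φ t p D) (fT mk fx κ Φ t p D)) (hκ : (hL κ Φ t p D (gT mk gx κ Φ t p D) (fT mk fx κ Φ t p D)).natAbs ≤ 10 * nL κ Φ t p D (gT mk gx κ Φ t p D) (fT mk fx κ Φ t p D))
    {σ' : ℤ} (hσ' : σ' = 1 ∨ σ' = -1) (yY : Site 2) (hΛ₁3 : |Λ₁of κ Φ t p D (gT mk gx κ Φ t p D) (fT mk fx κ Φ t p D) yY| ≤ 3 * modulus (nL κ Φ t p D (gT mk gx κ Φ t p D) (fT mk fx κ Φ t p D)) (hL κ Φ t p D (gT mk gx κ Φ t p D) (fT mk fx κ Φ t p D)) (vL κ Φ t p D (gT mk gx κ Φ t p D) (fT mk fx κ Φ t p D)) (Skelφ.NegPrm.vβOf (nL κ Φ t p D (gT mk gx κ Φ t p D) (fT mk fx κ Φ t p D)) (hL κ Φ t p D (gT mk gx κ Φ t p D) (fT mk fx κ Φ t p D)) (ℓL κ Φ t p D (gT mk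 gx κ Φ t p D) (fT mk fx κ Φ t p D)) (vL κ Φ t p D (gT mk gx κ Φ t p D) (fT mk fx κ Φ t p D)))) (hσ1 : σ' = -1) :
    20 * ((fcells κ Φ t p D (gT mk gx κ Φ t p D) (fT mk fx κ Φ t p D)).r 1 : ℤ) - (b0T κ Φ t p D (gT mk gx κ Φ t p D) (fT mk fx κ Φ t p D) 1 : ℤ) + 1 ≤ -(TwoAxis.Para.coarse (20 * ((fcells κ Φ t p D (gT mk gx κ Φ t p D) (fT mk fx κ Φ t p D)).K : ℤ) * (((fcells κ Φ t p D (gT mk gx κ Φ t p D) (fT mk fx κ Φ t p D)).s 1 : ℕ) : ℤ)) (Skelφ.NegPrm.Dof (nL κ Φ t p D (gT mk gx κ Φ t p D) (fT mk fx κ Φ t p D)) (hL κ Φ t p D (gT mk gx κ Φ t p D) (fT mk fx κ Φ t p D)) (ℓL κ Φ t p D (gT mk gx κ Φ t p D) (fT mk fx κ Φ t p D)) (vL κ Φ t p D (gT mk gx κ Φ t p D) (fT mk fx κ Φ t p D)) / 2) (Skelφ.NegPrm.Dof (nL κ Φ t p D (gT mk gx κ Φ t p D) (fT mk fx κ Φ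 t p D)) (hL κ Φ t p D (gT mk gx κ Φ t p D) (fT mk fx κ Φ t p D)) (ℓL κ Φ t p D (gT mk gx κ Φ t p D) (fT mk fx κ Φ t p D)) (vL κ Φ t p D (gT mk gx κ Φ t p D) (fT mk fx κ Φ t p D))) (TwoAxis.Para.lam1 800 (nL κ Φ t p D (gT mk gx κ Φ t p D) (fT mk fx κ Φ t p D) : ℤ) (hL κ Φ t p D (gT mk gx κ Φ t p D) (fT mk fx κ Φ t p D)) yY) +
        ((20 * ((fcells κ Φ t p D (gT mk gx κ Φ t p D) (fT mk fx κ Φ t p D)).K : ℤ) * (((fcells κ Φ t p D (gT mk gx κ Φ t p D) (fT mk fx κ Φ t p D)).s 1 : ℕ) : ℤ)) * (800 * ((shearUnit (nL κ Φ t p D (gT mk gx κ Φ t p D) (fT mk fx κ Φ t p D)) (hL κ Φ t p D (gT mk gx κ Φ t p D) (fT mk fx κ Φ t p D)) : ℤ) * (max (σ' * (mbLo κ Φ t p D (gT mk gx κ Φ t p D) (fT mk fx κ Φ t p D) mk (qY κ Φ t p D (gT mk gx κ Φ t p D) (fT mk fx κ Φ t p D) mk) (NyOf κ Φ t p D (gT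 mk gx κ Φ t p D) (fT mk fx κ Φ t p D) σ' yY))) (σ' * (mbHi κ Φ t p D (gT mk gx κ Φ t p D) (fT mk fx κ Φ t p D) mk (qY κ Φ t p D (gT mk gx κ Φ t p D) (fT mk fx κ Φ t p D) mk) (NyOf κ Φ t p D (gT mk gx κ Φ t p D) (fT mk fx κ Φ t p D) σ' yY)))) + (shearUnit (nL κ Φ t p D (gT mk gx κ Φ t p D) (fT mk fx κ Φ t p D)) (hL κ Φ t p D (gT mk gx κ Φ t p D) (fT mk fx κ Φ t p D)) : ℤ) - 1))) / (Skelφ.NegPrm.Dof (nL κ Φ t p D (gT mk gx κ Φ t p D) (fT mk fx κ Φ t p D)) (hL κ Φ t p D (gT mk gx κ Φ t p D) (fT mk fx κ Φ t p D)) (ℓL κ Φ t p D (gT mk gx κ Φ t p D) (fT mk fx κ Φ t p D)) (vL κ Φ t p D (gT mk gx κ Φ t p D) (fT mk fx κ Φ t p D))) + 1) ∧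
      -(TwoAxis.Para.coarse (20 * ((fcells κ Φ t p D (gT mk gx κ Φ t p D) (fT mk fx κ Φ t p D)).K : ℤ) * (((fcells κ Φ t p D (gT mk gx κ Φ t p D) (fT mk fx κ Φ t p D)).s 1 : ℕ) : ℤ)) (Skelφ.NegPrm.Dof (nL κ Φ t p D (gT mk gx κ Φ t p D) (fT mk fx κ Φ t p D)) (hL κ Φ t p D (gT mk gx κ Φ t p D) (fT mk fx κ Φ t p D)) (ℓL κ Φ t p D (gT mk gx κ Φ t p D) (fT mk fx κ Φ t p D)) (vL κ Φ t p D (gT mk gx κ Φ t p D) (fT mk fx κ Φ t p D)) / 2) (Skelφ.NegPrm.Dof (nL κ Φ t p D (gT mk gx κ Φ t p D) (fT mk fx κ Φ t p D)) (hL κ Φ t p D (gT mk gx κ Φ t p D) (fT mk fx κ Φ t p D)) (ℓL κ Φ t p D (gT mk gx κ Φ t p D) (fT mk fx κ Φ t p D)) (vL κ Φ t p D (gT mk gx κ Φ t p D) (fT mk fx κ Φ t p D))) (TwoAxis.Para.lam1 800 (nL κ Φ t p D (gT mk gx κ Φ t p D) (fT mk fx κ Φ t p D) : ℤ) (hL κ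 Φ t p D (gT mk gx κ Φ t p D) (fT mk fx κ Φ t p D)) yY) + ((20 * ((fcells κ Φ t p D (gT mk gx κ Φ t p D) (fT mk fx κ Φ t p D)).K : ℤ) * (((fcells κ Φ t p D (gT mk gx κ Φ t p D) (fT mk fx κ Φ t p D)).s 1 : ℕ) : ℤ)) * (800 * ((shearUnit (nL κ Φ t p D (gT mk gx κ Φ t p D) (fT mk fx κ Φ t p D)) (hL κ Φ t p D (gT mk gx κ Φ t p D) (fT mk fx κ Φ t p D)) : ℤ) * (min (σ' * (mbLo κ Φ t p D (gT mk gx κ Φ t p D) (fT mk fx κ Φ t p D) mk (qY κ Φ t p D (gT mk gx κ Φ t p D) (fT mk fx κ Φ t p D) mk) (NyOf κ Φ t p D (gT mk gx κ Φ t p D) (fT mk fx κ Φ t p D) σ' yY))) (σ' * (mbHi κ Φ t p D (gT mk gx κ Φ t p D) (fT mk fx κ Φ t p D) mk (qY κ Φ t p D (gT mk gx κ Φ t p D) (fT mk fx κ Φ t p D) mk) (NyOf κ Φ t p D (gT mk gx κ Φ t p D) (fT mk fx κ Φ t p D) σ' yY))) - 1)))) / (Skelφ.NegPrm.Dof (nL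 κ Φ t p D (gT mk gx κ Φ t p D) (fT mk fx κ Φ t p D)) (hL κ Φ t p D (gT mk gx κ Φ t p D) (fT mk fx κ Φ t p D)) (ℓL κ Φ t p D (gT mk gx κ Φ t p D) (fT mk fx κ Φ t p D)) (vL κ Φ t p D (gT mk gx κ Φ t p D) (fT mk fx κ Φ t p D)))) ≤ 20 * ((fcells κ Φ t p D (gT mk gx κ Φ t p D) (fT mk fx κ Φ t p D)).r 1 : ℤ) + (b0T κ Φ t p D (gT mk gx κ Φ t p D) (fT mk fx κ Φ t p D) 1 : ℤ) - 1 := by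
  obtain ⟨hn1, hℓ1⟩ := one_le_of_eqNumL κ Φ t p D _ _ hN
  have hm0 := (Skelφ.NegPrm.modulus_vβOf hn1 (hL κ Φ t p D (gT mk gx κ Φ t p D) (fT mk fx κ Φ t p D)) (ℓL κ Φ t p D (gT mk gx κ Φ t p D) (fT mk fx κ Φ t p D)) (vL κ Φ t p D (gT mk gx κ Φ t p D) (fT mk fx κ Φ t p D))).1
  have hmℓ := (Skelφ.NegPrm.modulus_vβOf hn1 (hL κ Φ t p D (gT mk gx κ Φ t p D) (fT mk fx κ Φ t p D)) (ℓL κ Φ t p D (gT mk gx κ Φ t p D) (fT mk fx κ Φ t p D)) (vL κ Φ t p D (gT mk gx κ Φ t p D) (fT mk fx κ Φ t p D))).2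
  have hm : (nL κ Φ t p D (gT mk gx κ Φ t p D) (fT mk fx κ Φ t p D) : ℤ) * ((ℓL κ Φ t p D (gT mk gx κ Φ t p D) (fT mk fx κ Φ t p D) : ℤ) - 1) < modulus (nL κ Φ t p D (gT mk gx κ Φ t p D) (fT mk fx κ Φ t p D)) (hL κ Φ t p D (gT mk gx κ Φ t p D) (fT mk fx κ Φ t p D)) (vL κ Φ t p D (gT mk gx κ Φ t p D) (fT mk fx κ Φ t p D)) (Skelφ.NegPrm.vβOf (nL κ Φ t p D (gT mk gx κ Φ t p D) (fT mk fx κ Φ t p D)) (hL κ Φ t p D (gT mk gx κ Φ t p D) (fT mk fx κ Φ t p D)) (ℓL κ Φ t p D (gT mk gx κ Φ t p D) (fT mk fx κ Φ t p D)) (vL κ Φ t p D (gT mk gx κ Φ t p D) (fT mk fx κ Φ t p D))) := by linarith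
  obtain ⟨hc0, hc1, hr0, hr1, hb0, hb1, hu0, hu1⟩ := units_eq κ Φ t p D (gT mk gx κ Φ t p D) (fT mk fx κ Φ t p D)
  have hv : |(vL κ Φ t p D (gT mk gx κ Φ t p D) (fT mk fx κ Φ t p D))| ≤ (nL κ Φ t p D (gT mk gx κ Φ t p D) (fT mk fx κ Φ t p D) : ℤ) := hN.v_le
  have hn : (1 : ℤ) ≤ (nL κ Φ t p D (gT mk gx κ Φ t p D) (fT mk fx κ Φ t p D) : ℤ) := by exact_mod_cast hn1
  have h10 : ((((hL κ Φ t p D (gT mk gx κ Φ t p D) (fT mk fx κ Φ t p D))).natAbs : ℤ)) ≤ 10 * (nL κ Φ t p D (gT mk gx κ Φ t p D) (fT mk fx κ Φ t p D) : ℤ) := by exact_mod_cast hκ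
  have h0' : (0 : ℤ) ≤ ((((hL κ Φ t p D (gT mk gx κ Φ t p D) (fT mk fx κ Φ t p D))).natAbs : ℤ)) := Nat.cast_nonneg _
  have hU : (nL κ Φ t p D (gT mk gx κ Φ t p D) (fT mk fx κ Φ t p D) : ℤ) ≤ (shearUnit (nL κ Φ t p D (gT mk gx κ Φ t p D) (fT mk fx κ Φ t p D)) (hL κ Φ t p D (gT mk gx κ Φ t p D) (fT mk fx κ Φ t p D)) : ℤ) ∧ (shearUnit (nL κ Φ t p D (gT mk gx κ Φ t p D) (fT mk fx κ Φ t p D)) (hL κ Φ t p D (gT mk gx κ Φ t p D) (fT mk fx κ Φ t p D)) : ℤ) ≤ 11 * (nL κ Φ t p D (gT mk gx κ Φ t p D) (fT mk fx κ Φ t p D) : ℤ) := by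
    unfold Skelφ.shearUnit; simp only [Nat.cast_add]; constructor <;> linarith
  have hRA : (0 : ℤ) ≤ (RA' κ Φ t p D mk : ℤ) := Nat.cast_nonneg _
  have hRAn : 2000 * ((RA' κ Φ t p D mk : ℤ) + 2) ≤ (nL κ Φ t p D (gT mk gx κ Φ t p D) (fT mk fx κ Φ t p D) : ℤ) := by
    have := (nL_floorsT κ Φ t p D mk fx (gT mk gx κ Φ t p D)).2.1; exact_mod_cast this
  have hRAℓ : 22000 * ((RA' κ Φ t p D mk : ℤ) + 2) ≤ (ℓL κ Φ t p D (gT mk gx κ Φ t p D) (fT mk fx κ Φ t p D) : ℤ) := by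
    have h1 : ((22000 * (RA' κ Φ t p D mk + 2) : ℕ) : ℤ) ≤ (ML κ Φ t p D (gT mk gx κ Φ t p D) : ℤ) := by exact_mod_cast (ML_floorsT κ Φ t p D mk gx).2.1
    have h2 := hN.ℓ_le
    push_cast at h1; linarith
  have hℓ44 : (44000 : ℤ) ≤ (ℓL κ Φ t p D (gT mk gx κ Φ t p D) (fT mk fx κ Φ t p D) : ℤ) := by linarith
  obtain ⟨sL, sH, sH', sLa⟩ := sY_spec κ Φ t p D (gT mk gx κ Φ t p D) (fT mk fx κ Φ t p D) hn1
  have hUqY : (shearUnit (nL κ Φ t p D (gT mk gx κ Φ t p D) (fT mk fx κ Φ t p D)) (hL κ Φ t p D (gT mk gx κ Φ t p D) (fT mk fx κ Φ t p D)) : ℤ) * ((qY κ Φ t p D (gT mk gx κ Φ t p D) (fT mk fx κ Φ t p D) mk) : ℤ) ≤ (nL κ Φ t p D (gT mk gx κ Φ t p D) (fT mk fx κ Φ t p D) : ℤ) * (ℓL κ Φ t p D (gT mk gx κ Φ t p D) (fT mk fx κ Φ t p D) : ℤ) + (shearUnit (nL κ Φ t p D (gT mk gx κ Φ t p D) (fT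 mk fx κ Φ t p D)) (hL κ Φ t p D (gT mk gx κ Φ t p D) (fT mk fx κ Φ t p D)) : ℤ) * (4 * (RA' κ Φ t p D mk : ℤ) + 4) := by
    unfold qY; push_cast
    have hW := (Wrun_spec κ Φ t p D (gT mk gx κ Φ t p D) (fT mk fx κ Φ t p D) hn1).1
    nlinarith [hU.1]
  have hmpos : 0 < modulus (nL κ Φ t p D (gT mk gx κ Φ t p D) (fT mk fx κ Φ t p D)) (hL κ Φ t p D (gT mk gx κ Φ t p D) (fT mk fx κ Φ t p D)) (vL κ Φ t p D (gT mk gx κ Φ t p D) (fT mk fx κ Φ t p D)) (Skelφ.NegPrm.vβOf (nL κ Φ t p D (gT mk gx κ Φ t p D) (fT mk fx κ Φ t p D)) (hL κ Φ t p D (gT mk gx κ Φ t p D) (fT mk fx κ Φ t p D)) (ℓL κ Φ t p D (gT mk gx κ Φ t p D) (fT mk fx κ Φ t p D)) (vL κ Φ t p D (gT mk gx κ Φ t p D) (fT mk fx κ Φ t p D))) := by linarith [mul_nonneg (show (0:ℤ) ≤ (nL κ Φ t p D (gT mk gx κ Φ t p D) (fT mk fx κ Φ t p D) : ℤ) by linarith)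 (show (0:ℤ) ≤ (ℓL κ Φ t p D (gT mk gx κ Φ t p D) (fT mk fx κ Φ t p D) : ℤ) - 1 by linarith)]
  obtain ⟨hN', hcen⟩ := NyOf_spec κ Φ t p D (gT mk gx κ Φ t p D) (fT mk fx κ Φ t p D) hN hσ' yY hΛ₁3
  -- the last core's level window: `U·mbLo − U ≥ (Ny+1)m − rβ`, `U·mbHi + U − 1 ≤ (Ny+1)m + rβ`, `rβ ≤ 2m + 3n`
  have hN0 : (0 : ℤ) ≤ ((NyOf κ Φ t p D (gT mk gx κ Φ t p D) (fT mk fx κ Φ t p D) σ' yY) : ℤ) := Nat.cast_nonneg _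
  have hUpos : (0:ℤ) < (shearUnit (nL κ Φ t p D (gT mk gx κ Φ t p D) (fT mk fx κ Φ t p D)) (hL κ Φ t p D (gT mk gx κ Φ t p D) (fT mk fx κ Φ t p D)) : ℤ) := by linarith
  have sL' : (shearUnit (nL κ Φ t p D (gT mk gx κ Φ t p D) (fT mk fx κ Φ t p D)) (hL κ Φ t p D (gT mk gx κ Φ t p D) (fT mk fx κ Φ t p D)) : ℤ) * sLoY κ Φ t p D (gT mk gx κ Φ t p D) (fT mk fx κ Φ t p D) ≤ (nL κ Φ t p D (gT mk gx κ Φ t p D) (fT mk fx κ Φ t p D) : ℤ) * (ℓL κ Φ t p D (gT mk gx κ Φ t p D) (fT mk fx κ Φ t p D) : ℤ) - (shearUnit (nL κ Φ t p D (gT mk gx κ Φ t p D) (fT mk fx κ Φ t p D)) (hL κ Φ t p D (gT mk gx κ Φ t p D) (fT mk fx κ Φ t p D)) : ℤ) + 1 := by unfold sLoY; exact Int.mul_ediv_self_le hUpos.ne'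
  have hbL : (((NyOf κ Φ t p D (gT mk gx κ Φ t p D) (fT mk fx κ Φ t p D) σ' yY) : ℤ) + 1) * modulus (nL κ Φ t p D (gT mk gx κ Φ t p D) (fT mk fx κ Φ t p D)) (hL κ Φ t p D (gT mk gx κ Φ t p D) (fT mk fx κ Φ t p D)) (vL κ Φ t p D (gT mk gx κ Φ t p D) (fT mk fx κ Φ t p D)) (Skelφ.NegPrm.vβOf (nL κ Φ t p D (gT mk gx κ Φ t p D) (fT mk fx κ Φ t p D)) (hL κ Φ t p D (gT mk gx κ Φ t p D) (fT mk fx κ Φ t p D)) (ℓL κ Φ t p D (gT mk gx κ Φ t p D) (fT mk fx κ Φ t p D)) (vL κ Φ t p D (gT mk gx κ Φ t p D) (fT mk fx κ Φ t p D))) - ((((NyOf κ Φ t p D (gT mk gx κ Φ t p D) (fT mk fx κ Φ t p D) σ' yY) : ℤ) + 1) * ((nL κ Φ t p D (gT mk gx κ Φ t p D) (fT mk fx κ Φ t p D) : ℤ) + 2 * (shearUnit (nL κ Φ t p D (gT mk gx κ Φ t p D) (fT mk fx κ Φ t p D)) (hL κ Φ t p D (gT mk gx κ Φ t p D) (fT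 mk fx κ Φ t p D)) : ℤ)) + (shearUnit (nL κ Φ t p D (gT mk gx κ Φ t p D) (fT mk fx κ Φ t p D)) (hL κ Φ t p D (gT mk gx κ Φ t p D) (fT mk fx κ Φ t p D)) : ℤ) * ((qY κ Φ t p D (gT mk gx κ Φ t p D) (fT mk fx κ Φ t p D) mk) : ℤ) + (((NyOf κ Φ t p D (gT mk gx κ Φ t p D) (fT mk fx κ Φ t p D) σ' yY) : ℤ) + 1) * ((shearUnit (nL κ Φ t p D (gT mk gx κ Φ t p D) (fT mk fx κ Φ t p D)) (hL κ Φ t p D (gT mk gx κ Φ t p D) (fT mk fx κ Φ t p D)) : ℤ) * (RA' κ Φ t p D mk : ℤ)) + (shearUnit (nL κ Φ t p D (gT mk gx κ Φ t p D) (fT mk fx κ Φ t p D)) (hL κ Φ t p D (gT mk gx κ Φ t p D) (fT mk fx κ Φ t p D)) : ℤ)) ≤ (shearUnit (nL κ Φ t p D (gT mk gx κ Φ t p D) (fT mk fx κ Φ t p D)) (hL κ Φ t p D (gT mk gx κ Φ t p D) (fT mk fx κ Φ t p D)) : ℤ) * mbLo κ Φ t p D (gT mk gx κ Φ t p D) (fT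 mk fx κ Φ t p D) mk (qY κ Φ t p D (gT mk gx κ Φ t p D) (fT mk fx κ Φ t p D) mk) (NyOf κ Φ t p D (gT mk gx κ Φ t p D) (fT mk fx κ Φ t p D) σ' yY) - (shearUnit (nL κ Φ t p D (gT mk gx κ Φ t p D) (fT mk fx κ Φ t p D)) (hL κ Φ t p D (gT mk gx κ Φ t p D) (fT mk fx κ Φ t p D)) : ℤ) := by
    unfold mbLo
    have e1 := mul_le_mul_of_nonneg_left sL (by linarith : (0:ℤ) ≤ ((NyOf κ Φ t p D (gT mk gx κ Φ t p D) (fT mk fx κ Φ t p D) σ' yY) : ℤ) + 1)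
    have e2 := mul_le_mul_of_nonneg_left hmℓ (by linarith : (0:ℤ) ≤ ((NyOf κ Φ t p D (gT mk gx κ Φ t p D) (fT mk fx κ Φ t p D) σ' yY) : ℤ) + 1)
    have e3 : (0:ℤ) ≤ (((NyOf κ Φ t p D (gT mk gx κ Φ t p D) (fT mk fx κ Φ t p D) σ' yY) : ℤ) + 1) * (nL κ Φ t p D (gT mk gx κ Φ t p D) (fT mk fx κ Φ t p D) : ℤ) := mul_nonneg (by linarith) (by linarith)
    linarith
  have hbH : (shearUnit (nL κ Φ t p D (gT mk gx κ Φ t p D) (fT mk fx κ Φ t p D)) (hL κ Φ t p D (gT mk gx κ Φ t p D) (fT mk fx κ Φ t p D)) : ℤ) * mbHi κ Φ t p D (gT mk gx κ Φ t p D) (fT mk fx κ Φ t p D) mk (qY κ Φ t p D (gT mk gx κ Φ t p D) (fT mk fx κ Φ t p D) mk) (NyOf κ Φ t p D (gT mk gx κ Φ t p D) (fT mk fx κ Φ t p D) σ' yY) + (shearUnit (nL κ Φ t p D (gT mk gx κ Φ t p D) (fT mk fx κ Φ t p D)) (hL κ Φ t p D (gT mk gx κ Φ t p D) (fT mk fx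 κ Φ t p D)) : ℤ) - 1 ≤ (((NyOf κ Φ t p D (gT mk gx κ Φ t p D) (fT mk fx κ Φ t p D) σ' yY) : ℤ) + 1) * modulus (nL κ Φ t p D (gT mk gx κ Φ t p D) (fT mk fx κ Φ t p D)) (hL κ Φ t p D (gT mk gx κ Φ t p D) (fT mk fx κ Φ t p D)) (vL κ Φ t p D (gT mk gx κ Φ t p D) (fT mk fx κ Φ t p D)) (Skelφ.NegPrm.vβOf (nL κ Φ t p D (gT mk gx κ Φ t p D) (fT mk fx κ Φ t p D)) (hL κ Φ t p D (gT mk gx κ Φ t p D) (fT mk fx κ Φ t p D)) (ℓL κ Φ t p D (gT mk gx κ Φ t p D) (fT mk fx κ Φ t p D)) (vL κ Φ t p D (gT mk gx κ Φ t p D) (fT mk fx κ Φ t p D))) + ((((NyOf κ Φ t p D (gT mk gx κ Φ t p D) (fT mk fx κ Φ t p D) σ' yY) : ℤ) + 1) * ((nL κ Φ t p D (gT mk gx κ Φ t p D) (fT mk fx κ Φ t p D) : ℤ) + 2 * (shearUnit (nL κ Φ t p D (gT mk gx κ Φ t p D) (fT mk fx κ Φ t p D)) (hL κ Φ t p D (gT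 mk gx κ Φ t p D) (fT mk fx κ Φ t p D)) : ℤ)) + (shearUnit (nL κ Φ t p D (gT mk gx κ Φ t p D) (fT mk fx κ Φ t p D)) (hL κ Φ t p D (gT mk gx κ Φ t p D) (fT mk fx κ Φ t p D)) : ℤ) * ((qY κ Φ t p D (gT mk gx κ Φ t p D) (fT mk fx κ Φ t p D) mk) : ℤ) + (((NyOf κ Φ t p D (gT mk gx κ Φ t p D) (fT mk fx κ Φ t p D) σ' yY) : ℤ) + 1) * ((shearUnit (nL κ Φ t p D (gT mk gx κ Φ t p D) (fT mk fx κ Φ t p D)) (hL κ Φ t p D (gT mk gx κ Φ t p D) (fT mk fx κ Φ t p D)) : ℤ) * (RA' κ Φ t p D mk : ℤ)) + (shearUnit (nL κ Φ t p D (gT mk gx κ Φ t p D) (fT mk fx κ Φ t p D)) (hL κ Φ t p D (gT mk gx κ Φ t p D) (fT mk fx κ Φ t p D)) : ℤ)) := by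
    unfold mbHi
    have e1 := mul_le_mul_of_nonneg_left sH (by linarith : (0:ℤ) ≤ ((NyOf κ Φ t p D (gT mk gx κ Φ t p D) (fT mk fx κ Φ t p D) σ' yY) : ℤ) + 1)
    have e2 := mul_le_mul_of_nonneg_left (show (nL κ Φ t p D (gT mk gx κ Φ t p D) (fT mk fx κ Φ t p D) : ℤ) * (ℓL κ Φ t p D (gT mk gx κ Φ t p D) (fT mk fx κ Φ t p D) : ℤ) ≤ modulus (nL κ Φ t p D (gT mk gx κ Φ t p D) (fT mk fx κ Φ t p D)) (hL κ Φ t p D (gT mk gx κ Φ t p D) (fT mk fx κ Φ t p D)) (vL κ Φ t p D (gT mk gx κ Φ t p D) (fT mk fx κ Φ t p D)) (Skelφ.NegPrm.vβOf (nL κ Φ t p D (gT mk gx κ Φ t p D) (fT mk fx κ Φ t p D)) (hL κ Φ t p D (gT mk gx κ Φ t p D) (fT mk fx κ Φ t p D)) (ℓL κ Φ t p D (gT mk gx κ Φ t p D) (fT mk fx κ Φ t p D)) (vL κ Φ t p D (gT mk gx κ Φ t p D) (fT mk fx κ Φ t p D))) + (nL κ Φ t p D (gT mk gx κ Φ t p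 D) (fT mk fx κ Φ t p D) : ℤ) by linarith) (by linarith : (0:ℤ) ≤ ((NyOf κ Φ t p D (gT mk gx κ Φ t p D) (fT mk fx κ Φ t p D) σ' yY) : ℤ) + 1)
    have e3 : (0:ℤ) ≤ (((NyOf κ Φ t p D (gT mk gx κ Φ t p D) (fT mk fx κ Φ t p D) σ' yY) : ℤ) + 1) * (shearUnit (nL κ Φ t p D (gT mk gx κ Φ t p D) (fT mk fx κ Φ t p D)) (hL κ Φ t p D (gT mk gx κ Φ t p D) (fT mk fx κ Φ t p D)) : ℤ) := mul_nonneg (by linarith) hUpos.le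
    linarith
  have hbLH : mbLo κ Φ t p D (gT mk gx κ Φ t p D) (fT mk fx κ Φ t p D) mk (qY κ Φ t p D (gT mk gx κ Φ t p D) (fT mk fx κ Φ t p D) mk) (NyOf κ Φ t p D (gT mk gx κ Φ t p D) (fT mk fx κ Φ t p D) σ' yY) ≤ mbHi κ Φ t p D (gT mk gx κ Φ t p D) (fT mk fx κ Φ t p D) mk (qY κ Φ t p D (gT mk gx κ Φ t p D) (fT mk fx κ Φ t p D) mk) (NyOf κ Φ t p D (gT mk gx κ Φ t p D) (fT mk fx κ Φ t p D) σ' yY) := by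
    unfold mbLo mbHi
    have hss : sLoY κ Φ t p D (gT mk gx κ Φ t p D) (fT mk fx κ Φ t p D) < sHiY κ Φ t p D (gT mk gx κ Φ t p D) (fT mk fx κ Φ t p D) := by
      by_contra hc; push Not at hc
      have := mul_le_mul_of_nonneg_left hc hUpos.le
      linarith
    have e3 : (0:ℤ) ≤ (((NyOf κ Φ t p D (gT mk gx κ Φ t p D) (fT mk fx κ Φ t p D) σ' yY) : ℤ) + 1) * (RA' κ Φ t p D mk : ℤ) := mul_nonneg (by linarith) hRA
    have e4 := mul_le_mul_of_nonneg_left hss.le (by linarith : (0:ℤ) ≤ ((NyOf κ Φ t p D (gT mk gx κ Φ t p D) (fT mk fx κ Φ t p D) σ' yY) : ℤ) + 1)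
    have hq0 : (0:ℤ) ≤ ((qY κ Φ t p D (gT mk gx κ Φ t p D) (fT mk fx κ Φ t p D) mk) : ℤ) := Nat.cast_nonneg _
    linarith
  have hrβ' : ((((NyOf κ Φ t p D (gT mk gx κ Φ t p D) (fT mk fx κ Φ t p D) σ' yY) : ℤ) + 1) * ((nL κ Φ t p D (gT mk gx κ Φ t p D) (fT mk fx κ Φ t p D) : ℤ) + 2 * (shearUnit (nL κ Φ t p D (gT mk gx κ Φ t p D) (fT mk fx κ Φ t p D)) (hL κ Φ t p D (gT mk gx κ Φ t p D) (fT mk fx κ Φ t p D)) : ℤ)) + (shearUnit (nL κ Φ t p D (gT mk gx κ Φ t p D) (fT mk fx κ Φ t p D)) (hL κ Φ t p D (gT mk gx κ Φ t p D) (fT mk fx κ Φ t p D)) : ℤ) * ((qY κ Φ t p D (gT mk gx κ Φ t p D) (fT mk fx κ Φ t p D) mk) : ℤ) + (((NyOf κ Φ t p D (gT mk gx κ Φ t p D) (fT mk fx κ Φ t p D) σ' yY) : ℤ) + 1) * ((shearUnit (nL κ Φ t p D (gT mk gx κ Φ t p D) (fT mk fx κ Φ t p D)) (hL κ Φ t p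 D (gT mk gx κ Φ t p D) (fT mk fx κ Φ t p D)) : ℤ) * (RA' κ Φ t p D mk : ℤ)) + (shearUnit (nL κ Φ t p D (gT mk gx κ Φ t p D) (fT mk fx κ Φ t p D)) (hL κ Φ t p D (gT mk gx κ Φ t p D) (fT mk fx κ Φ t p D)) : ℤ)) ≤ 2 * modulus (nL κ Φ t p D (gT mk gx κ Φ t p D) (fT mk fx κ Φ t p D)) (hL κ Φ t p D (gT mk gx κ Φ t p D) (fT mk fx κ Φ t p D)) (vL κ Φ t p D (gT mk gx κ Φ t p D) (fT mk fx κ Φ t p D)) (Skelφ.NegPrm.vβOf (nL κ Φ t p D (gT mk gx κ Φ t p D) (fT mk fx κ Φ t p D)) (hL κ Φ t p D (gT mk gx κ Φ t p D) (fT mk fx κ Φ t p D)) (ℓL κ Φ t p D (gT mk gx κ Φ t p D) (fT mk fx κ Φ t p D)) (vL κ Φ t p D (gT mk gx κ Φ t p D) (fT mk fx κ Φ t p D))) + 3 * (nL κ Φ t p D (gT mk gx κ Φ t p D) (fT mk fx κ Φ t p D) : ℤ) := by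
    have hN1 : ((NyOf κ Φ t p D (gT mk gx κ Φ t p D) (fT mk fx κ Φ t p D) σ' yY) : ℤ) + 1 ≤ 1000 := by
      have h' : ((0 + 1 + 3 + 1 + NyOf κ Φ t p D (gT mk gx κ Φ t p D) (fT mk fx κ Φ t p D) σ' yY : ℕ) : ℤ) ≤ 1000 := by exact_mod_cast hN'
      push_cast at h'; linarith
    have t1 : (((NyOf κ Φ t p D (gT mk gx κ Φ t p D) (fT mk fx κ Φ t p D) σ' yY) : ℤ) + 1) * ((nL κ Φ t p D (gT mk gx κ Φ t p D) (fT mk fx κ Φ t p D) : ℤ) + 2 * (shearUnit (nL κ Φ t p D (gT mk gx κ Φ t p D) (fT mk fx κ Φ t p D)) (hL κ Φ t p D (gT mk gx κ Φ t p D) (fT mk fx κ Φ t p D)) : ℤ)) ≤ 1000 * (23 * (nL κ Φ t p D (gT mk gx κ Φ t p D) (fT mk fx κ Φ t p D) : ℤ)) := mul_le_mul hN1 (by linarith [hU.2]) (by linarith [hU.1]) (by norm_num)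
    have t2 : (((NyOf κ Φ t p D (gT mk gx κ Φ t p D) (fT mk fx κ Φ t p D) σ' yY) : ℤ) + 1) * ((shearUnit (nL κ Φ t p D (gT mk gx κ Φ t p D) (fT mk fx κ Φ t p D)) (hL κ Φ t p D (gT mk gx κ Φ t p D) (fT mk fx κ Φ t p D)) : ℤ) * (RA' κ Φ t p D mk : ℤ)) ≤ 1000 * (11 * (nL κ Φ t p D (gT mk gx κ Φ t p D) (fT mk fx κ Φ t p D) : ℤ) * (RA' κ Φ t p D mk : ℤ)) :=
      mul_le_mul hN1 (mul_le_mul_of_nonneg_right hU.2 hRA) (mul_nonneg hUpos.le hRA) (by norm_num)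
    have t3 : (shearUnit (nL κ Φ t p D (gT mk gx κ Φ t p D) (fT mk fx κ Φ t p D)) (hL κ Φ t p D (gT mk gx κ Φ t p D) (fT mk fx κ Φ t p D)) : ℤ) * (4 * (RA' κ Φ t p D mk : ℤ) + 4) ≤ 11 * (nL κ Φ t p D (gT mk gx κ Φ t p D) (fT mk fx κ Φ t p D) : ℤ) * (4 * (RA' κ Φ t p D mk : ℤ) + 4) := mul_le_mul_of_nonneg_right hU.2 (by linarith)
    have t4 : (nL κ Φ t p D (gT mk gx κ Φ t p D) (fT mk fx κ Φ t p D) : ℤ) * (22000 * ((RA' κ Φ t p D mk : ℤ) + 2)) ≤ (nL κ Φ t p D (gT mk gx κ Φ t p D) (fT mk fx κ Φ t p D) : ℤ) * (ℓL κ Φ t p D (gT mk gx κ Φ t p D) (fT mk fx κ Φ t p D) : ℤ) := mul_le_mul_of_nonneg_left hRAℓ (by linarith)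
    have t5 : (0:ℤ) ≤ (nL κ Φ t p D (gT mk gx κ Φ t p D) (fT mk fx κ Φ t p D) : ℤ) * (RA' κ Φ t p D mk : ℤ) := mul_nonneg (by linarith) hRA
    linarith [hU.2]
  have ec : F1c κ Φ t p D (gT mk gx κ Φ t p D) (fT mk fx κ Φ t p D) yY + σ' * u₁ κ Φ t p D (gT mk gx κ Φ t p D) (fT mk fx κ Φ t p D) * (((NyOf κ Φ t p D (gT mk gx κ Φ t p D) (fT mk fx κ Φ t p D) σ' yY) : ℤ) + 1) - σ' * 800 * u₁ κ Φ t p D (gT mk gx κ Φ t p D) (fT mk fx κ Φ t p D) = F1c κ Φ t p D (gT mk gx κ Φ t p D) (fT mk fx κ Φ t p D) yY - u₁ κ Φ t p D (gT mk gx κ Φ t p D) (fT mk fx κ Φ t p D) * (((NyOf κ Φ t p D (gT mk gx κ Φ t p D) (fT mk fx κ Φ t p D) σ' yY) : ℤ) + 1) + 800 * u₁ κ Φ t p D (gT mk gx κ Φ t p D) (fT mk fx κ Φ t p D) := by rw [hσ1]; ring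
  rw [ec, F1c_eq] at hcen
  unfold TwoAxis.Para.coarse
  rw [hc1, Dof_eq', (lam_eq κ Φ t p D (gT mk gx κ Φ t p D) (fT mk fx κ Φ t p D) yY).2]
  have e1 : 20 * ((fcells κ Φ t p D (gT mk gx κ Φ t p D) (fT mk fx κ Φ t p D)).r 1 : ℤ) - (b0T κ Φ t p D (gT mk gx κ Φ t p D) (fT mk fx κ Φ t p D) 1 : ℤ) + 1 = 800 * u₁ κ Φ t p D (gT mk gx κ Φ t p D) (fT mk fx κ Φ t p D) - 10 * u₁ κ Φ t p D (gT mk gx κ Φ t p D) (fT mk fx κ Φ t p D) + 1 := by rw [hr1, hb1]; ring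
  have e2 : 20 * ((fcells κ Φ t p D (gT mk gx κ Φ t p D) (fT mk fx κ Φ t p D)).r 1 : ℤ) + (b0T κ Φ t p D (gT mk gx κ Φ t p D) (fT mk fx κ Φ t p D) 1 : ℤ) - 1 = 800 * u₁ κ Φ t p D (gT mk gx κ Φ t p D) (fT mk fx κ Φ t p D) + 10 * u₁ κ Φ t p D (gT mk gx κ Φ t p D) (fT mk fx κ Φ t p D) - 1 := by rw [hr1, hb1]; ring
  rw [e1, e2]
  exact RootArith.alongY_neg (u := u₁ κ Φ t p D (gT mk gx κ Φ t p D) (fT mk fx κ Φ t p D)) (Λ := Λ₁of κ Φ t p D (gT mk gx κ Φ t p D) (fT mk fx κ Φ t p D) yY) hu1 hn hm hU.1 hU.2 hℓ44 hσ1 hbL hbLH hbH hrβ' hcen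

/-- **`hLg₃` of the y′-leg** (either `σ'`): the last core's fine abscissa within `±(b0T₀ − 1)` — needs the sharp origin size `4|Λ₀(yX)| ≤ 7m` (floor `64S ≤ M_L`,
i.e. `gx := KS.gxR2`) and `u₀ = Kq s₀ ≥ 17`. [cite: KozmaNitzan2024, §4 Lemma 11 (p. 22)] -/
theorem hLgY₃_R (hN : EqNumL κ Φ t p D (gT mk gx κ Φ t p D) (fT mk fx κ Φ t p D)) (hκ : (hL κ Φ t p D (gT mk gx κ Φ t p D) (fT mk fx κ Φ t p D)).natAbs ≤ 10 * nL κ Φ t p D (gT mk gx κ Φ t p D) (fT mk fx κ Φ t p D))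
    {σu σ' : ℤ} (hσu : σu = 1 ∨ σu = -1) (hσ' : σ' = 1 ∨ σ' = -1) (yX yY : Site 2) (hΛ₁3 : |Λ₁of κ Φ t p D (gT mk gx κ Φ t p D) (fT mk fx κ Φ t p D) yY| ≤ 3 * modulus (nL κ Φ t p D (gT mk gx κ Φ t p D) (fT mk fx κ Φ t p D)) (hL κ Φ t p D (gT mk gx κ Φ t p D) (fT mk fx κ Φ t p D)) (vL κ Φ t p D (gT mk gx κ Φ t p D) (fT mk fx κ Φ t p D)) (Skelφ.NegPrm.vβOf (nL κ Φ t p D (gT mk gx κ Φ t p D) (fT mk fx κ Φ t p D)) (hL κ Φ t p D (gT mk gx κ Φ t p D) (fT mk fx κ Φ t p D)) (ℓL κ Φ t p D (gT mk gx κ Φ t p D) (fT mk fx κ Φ t p D)) (vL κ Φ t p D (gT mk gx κ Φ t p D) (fT mk fx κ Φ t p D))))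
    {ρ : ℤ} (hρ0 : 0 ≤ ρ) (hρ1' : ρ < (nL κ Φ t p D (gT mk gx κ Φ t p D) (fT mk fx κ Φ t p D) : ℤ))
    (hrel : (nL κ Φ t p D (gT mk gx κ Φ t p D) (fT mk fx κ Φ t p D) : ℤ) * Λ₀of κ Φ t p D (gT mk gx κ Φ t p D) (fT mk fx κ Φ t p D) yY = (nL κ Φ t p D (gT mk gx κ Φ t p D) (fT mk fx κ Φ t p D) : ℤ) * Λ₀of κ Φ t p D (gT mk gx κ Φ t p D) (fT mk fx κ Φ t p D) yX + 4 * σu * (nL κ Φ t p D (gT mk gx κ Φ t p D) (fT mk fx κ Φ t p D) : ℤ) * modulus (nL κ Φ t p D (gT mk gx κ Φ t p D) (fT mk fx κ Φ t p D)) (hL κ Φ t p D (gT mk gx κ Φ t p D) (fT mk fx κ Φ t p D)) (vL κ Φ t p D (gT mk gx κ Φ t p D) (fT mk fx κ Φ t p D)) (Skelφ.NegPrm.vβOf (nL κ Φ t p D (gT mk gx κ Φ t p D) (fT mk fx κ Φ t p D)) (hL κ Φ t p D (gT mk gx κ Φ t p D) (fT mk fx κ Φ t p D)) (ℓL κ Φ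 t p D (gT mk gx κ Φ t p D) (fT mk fx κ Φ t p D)) (vL κ Φ t p D (gT mk gx κ Φ t p D) (fT mk fx κ Φ t p D))) + σ' * vL κ Φ t p D (gT mk gx κ Φ t p D) (fT mk fx κ Φ t p D) * modulus (nL κ Φ t p D (gT mk gx κ Φ t p D) (fT mk fx κ Φ t p D)) (hL κ Φ t p D (gT mk gx κ Φ t p D) (fT mk fx κ Φ t p D)) (vL κ Φ t p D (gT mk gx κ Φ t p D) (fT mk fx κ Φ t p D)) (Skelφ.NegPrm.vβOf (nL κ Φ t p D (gT mk gx κ Φ t p D) (fT mk fx κ Φ t p D)) (hL κ Φ t p D (gT mk gx κ Φ t p D) (fT mk fx κ Φ t p D)) (ℓL κ Φ t p D (gT mk gx κ Φ t p D) (fT mk fx κ Φ t p D)) (vL κ Φ t p D (gT mk gx κ Φ t p D) (fT mk fx κ Φ t p D))) + vL κ Φ t p D (gT mk gx κ Φ t p D) (fT mk fx κ Φ t p D) * ρ)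
    (hΛ₀ : 4 * |Λ₀of κ Φ t p D (gT mk gx κ Φ t p D) (fT mk fx κ Φ t p D) yX| ≤ 7 * modulus (nL κ Φ t p D (gT mk gx κ Φ t p D) (fT mk fx κ Φ t p D)) (hL κ Φ t p D (gT mk gx κ Φ t p D) (fT mk fx κ Φ t p D)) (vL κ Φ t p D (gT mk gx κ Φ t p D) (fT mk fx κ Φ t p D)) (Skelφ.NegPrm.vβOf (nL κ Φ t p D (gT mk gx κ Φ t p D) (fT mk fx κ Φ t p D)) (hL κ Φ t p D (gT mk gx κ Φ t p D) (fT mk fx κ Φ t p D)) (ℓL κ Φ t p D (gT mk gx κ Φ t p D) (fT mk fx κ Φ t p D)) (vL κ Φ t p D (gT mk gx κ Φ t p D) (fT mk fx κ Φ t p D)))) :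
    -((b0T κ Φ t p D (gT mk gx κ Φ t p D) (fT mk fx κ Φ t p D) 0 : ℤ) - 1) ≤ TwoAxis.Para.coarse (20 * ((fcells κ Φ t p D (gT mk gx κ Φ t p D) (fT mk fx κ Φ t p D)).K : ℤ) * (((fcells κ Φ t p D (gT mk gx κ Φ t p D) (fT mk fx κ Φ t p D)).s 0 : ℕ) : ℤ)) (Skelφ.NegPrm.Dof (nL κ Φ t p D (gT mk gx κ Φ t p D) (fT mk fx κ Φ t p D)) (hL κ Φ t p D (gT mk gx κ Φ t p D) (fT mk fx κ Φ t p D)) (ℓL κ Φ t p D (gT mk gx κ Φ t p D) (fT mk fx κ Φ t p D)) (vL κ Φ t p D (gT mk gx κ Φ t p D) (fT mk fx κ Φ t p D)) / 2) (Skelφ.NegPrm.Dof (nL κ Φ t p D (gT mk gx κ Φ t p D) (fT mk fx κ Φ t p D)) (hL κ Φ t p D (gT mk gx κ Φ t p D) (fT mk fx κ Φ t p D)) (ℓL κ Φ t p D (gT mk gx κ Φ t p D) (fT mk fx κ Φ t p D)) (vL κ Φ t p D (gT mk gx κ Φ t p D) (fT mk fx κ Φ t p D))) (TwoAxis.Para.lam0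 800 (vL κ Φ t p D (gT mk gx κ Φ t p D) (fT mk fx κ Φ t p D)) (Skelφ.NegPrm.vβOf (nL κ Φ t p D (gT mk gx κ Φ t p D) (fT mk fx κ Φ t p D)) (hL κ Φ t p D (gT mk gx κ Φ t p D) (fT mk fx κ Φ t p D)) (ℓL κ Φ t p D (gT mk gx κ Φ t p D) (fT mk fx κ Φ t p D)) (vL κ Φ t p D (gT mk gx κ Φ t p D) (fT mk fx κ Φ t p D))) yY) +
        ((20 * ((fcells κ Φ t p D (gT mk gx κ Φ t p D) (fT mk fx κ Φ t p D)).K : ℤ) * (((fcells κ Φ t p D (gT mk gx κ Φ t p D) (fT mk fx κ Φ t p D)).s 0 : ℕ) : ℤ)) * (800 * (modulus (nL κ Φ t p D (gT mk gx κ Φ t p D) (fT mk fx κ Φ t p D)) (hL κ Φ t p D (gT mk gx κ Φ t p D) (fT mk fx κ Φ t p D)) (vL κ Φ t p D (gT mk gx κ Φ t p D) (fT mk fx κ Φ t p D)) (Skelφ.NegPrm.vβOf (nL κ Φ t p D (gT mk gx κ Φ t p D) (fT mk fx κ Φ t p D)) (hL κ Φ t p D (gT mk gx κ Φ t p D) (fT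 mk fx κ Φ t p D)) (ℓL κ Φ t p D (gT mk gx κ Φ t p D) (fT mk fx κ Φ t p D)) (vL κ Φ t p D (gT mk gx κ Φ t p D) (fT mk fx κ Φ t p D))) * (min (σ' * (maLo κ Φ t p D (gT mk gx κ Φ t p D) (fT mk fx κ Φ t p D) mk (NyOf κ Φ t p D (gT mk gx κ Φ t p D) (fT mk fx κ Φ t p D) σ' yY))) (σ' * (maHi κ Φ t p D (gT mk gx κ Φ t p D) (fT mk fx κ Φ t p D) mk (NyOf κ Φ t p D (gT mk gx κ Φ t p D) (fT mk fx κ Φ t p D) σ' yY)))) -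
          max ((vL κ Φ t p D (gT mk gx κ Φ t p D) (fT mk fx κ Φ t p D)) * ((shearUnit (nL κ Φ t p D (gT mk gx κ Φ t p D) (fT mk fx κ Φ t p D)) (hL κ Φ t p D (gT mk gx κ Φ t p D) (fT mk fx κ Φ t p D)) : ℤ) * (min (σ' * (mbLo κ Φ t p D (gT mk gx κ Φ t p D) (fT mk fx κ Φ t p D) mk (qY κ Φ t p D (gT mk gx κ Φ t p D) (fT mk fx κ Φ t p D) mk) (NyOf κ Φ t p D (gT mk gx κ Φ t p D) (fT mk fx κ Φ t p D) σ' yY))) (σ' * (mbHi κ Φ t p D (gT mk gx κ Φ t p D) (fT mk fx κ Φ t p D) mk (qY κ Φ t p D (gT mk gx κ Φ t p D) (fT mk fx κ Φ t p D) mk) (NyOf κ Φ t p D (gT mk gx κ Φ t p D) (fT mk fx κ Φ t p D) σ' yY))) - 1))) ((vL κ Φ t p D (gT mk gx κ Φ t p D) (fT mk fx κ Φ t p D)) * ((shearUnit (nL κ Φ t p D (gT mk gx κ Φ t p D) (fT mk fx κ Φ t p D)) (hL κ Φ t p D (gT mk gx κ Φ t p D) (fT mk fx κ Φ t p D)) :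 ℤ) * (max (σ' * (mbLo κ Φ t p D (gT mk gx κ Φ t p D) (fT mk fx κ Φ t p D) mk (qY κ Φ t p D (gT mk gx κ Φ t p D) (fT mk fx κ Φ t p D) mk) (NyOf κ Φ t p D (gT mk gx κ Φ t p D) (fT mk fx κ Φ t p D) σ' yY))) (σ' * (mbHi κ Φ t p D (gT mk gx κ Φ t p D) (fT mk fx κ Φ t p D) mk (qY κ Φ t p D (gT mk gx κ Φ t p D) (fT mk fx κ Φ t p D) mk) (NyOf κ Φ t p D (gT mk gx κ Φ t p D) (fT mk fx κ Φ t p D) σ' yY)))) + (shearUnit (nL κ Φ t p D (gT mk gx κ Φ t p D) (fT mk fx κ Φ t p D)) (hL κ Φ t p D (gT mk gx κ Φ t p D) (fT mk fx κ Φ t p D)) : ℤ) - 1))) / (nL κ Φ t p D (gT mk gx κ Φ t p D) (fT mk fx κ Φ t p D) : ℤ))) / (Skelφ.NegPrm.Dof (nL κ Φ t p D (gT mk gx κ Φ t p D) (fT mk fx κ Φ t p D)) (hL κ Φ t p D (gT mk gx κ Φ t p D) (fT mk fx κ Φ t p D)) (ℓL κ Φ t p D (gT mk gx κ Φ t p D)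 (fT mk fx κ Φ t p D)) (vL κ Φ t p D (gT mk gx κ Φ t p D) (fT mk fx κ Φ t p D))) ∧
      TwoAxis.Para.coarse (20 * ((fcells κ Φ t p D (gT mk gx κ Φ t p D) (fT mk fx κ Φ t p D)).K : ℤ) * (((fcells κ Φ t p D (gT mk gx κ Φ t p D) (fT mk fx κ Φ t p D)).s 0 : ℕ) : ℤ)) (Skelφ.NegPrm.Dof (nL κ Φ t p D (gT mk gx κ Φ t p D) (fT mk fx κ Φ t p D)) (hL κ Φ t p D (gT mk gx κ Φ t p D) (fT mk fx κ Φ t p D)) (ℓL κ Φ t p D (gT mk gx κ Φ t p D) (fT mk fx κ Φ t p D)) (vL κ Φ t p D (gT mk gx κ Φ t p D) (fT mk fx κ Φ t p D)) / 2) (Skelφ.NegPrm.Dof (nL κ Φ t p D (gT mk gx κ Φ t p D) (fT mk fx κ Φ t p D)) (hL κ Φ t p D (gT mk gx κ Φ t p D) (fT mk fx κ Φ t p D)) (ℓL κ Φ t p D (gT mk gx κ Φ t p D) (fT mk fx κ Φ t p D)) (vL κ Φ t p D (gT mk gx κ Φ t p D) (fT mk fx κ Φ t p D))) (TwoAxis.Para.lam0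 800 (vL κ Φ t p D (gT mk gx κ Φ t p D) (fT mk fx κ Φ t p D)) (Skelφ.NegPrm.vβOf (nL κ Φ t p D (gT mk gx κ Φ t p D) (fT mk fx κ Φ t p D)) (hL κ Φ t p D (gT mk gx κ Φ t p D) (fT mk fx κ Φ t p D)) (ℓL κ Φ t p D (gT mk gx κ Φ t p D) (fT mk fx κ Φ t p D)) (vL κ Φ t p D (gT mk gx κ Φ t p D) (fT mk fx κ Φ t p D))) yY) +
        ((20 * ((fcells κ Φ t p D (gT mk gx κ Φ t p D) (fT mk fx κ Φ t p D)).K : ℤ) * (((fcells κ Φ t p D (gT mk gx κ Φ t p D) (fT mk fx κ Φ t p D)).s 0 : ℕ) : ℤ)) * (800 * (modulus (nL κ Φ t p D (gT mk gx κ Φ t p D) (fT mk fx κ Φ t p D)) (hL κ Φ t p D (gT mk gx κ Φ t p D) (fT mk fx κ Φ t p D)) (vL κ Φ t p D (gT mk gx κ Φ t p D) (fT mk fx κ Φ t p D)) (Skelφ.NegPrm.vβOf (nL κ Φ t p D (gT mk gx κ Φ t p D) (fT mk fx κ Φ t p D)) (hL κ Φ t p D (gT mk gx κ Φ t p D) (fT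 mk fx κ Φ t p D)) (ℓL κ Φ t p D (gT mk gx κ Φ t p D) (fT mk fx κ Φ t p D)) (vL κ Φ t p D (gT mk gx κ Φ t p D) (fT mk fx κ Φ t p D))) * (max (σ' * (maLo κ Φ t p D (gT mk gx κ Φ t p D) (fT mk fx κ Φ t p D) mk (NyOf κ Φ t p D (gT mk gx κ Φ t p D) (fT mk fx κ Φ t p D) σ' yY))) (σ' * (maHi κ Φ t p D (gT mk gx κ Φ t p D) (fT mk fx κ Φ t p D) mk (NyOf κ Φ t p D (gT mk gx κ Φ t p D) (fT mk fx κ Φ t p D) σ' yY)))) -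
          min ((vL κ Φ t p D (gT mk gx κ Φ t p D) (fT mk fx κ Φ t p D)) * ((shearUnit (nL κ Φ t p D (gT mk gx κ Φ t p D) (fT mk fx κ Φ t p D)) (hL κ Φ t p D (gT mk gx κ Φ t p D) (fT mk fx κ Φ t p D)) : ℤ) * (min (σ' * (mbLo κ Φ t p D (gT mk gx κ Φ t p D) (fT mk fx κ Φ t p D) mk (qY κ Φ t p D (gT mk gx κ Φ t p D) (fT mk fx κ Φ t p D) mk) (NyOf κ Φ t p D (gT mk gx κ Φ t p D) (fT mk fx κ Φ t p D) σ' yY))) (σ' * (mbHi κ Φ t p D (gT mk gx κ Φ t p D) (fT mk fx κ Φ t p D) mk (qY κ Φ t p D (gT mk gx κ Φ t p D) (fT mk fx κ Φ t p D) mk) (NyOf κ Φ t p D (gT mk gx κ Φ t p D) (fT mk fx κ Φ t p D) σ' yY))) - 1))) ((vL κ Φ t p D (gT mk gx κ Φ t p D) (fT mk fx κ Φ t p D)) * ((shearUnit (nL κ Φ t p D (gT mk gx κ Φ t p D) (fT mk fx κ Φ t p D)) (hL κ Φ t p D (gT mk gx κ Φ t p D) (fT mk fx κ Φ t p D)) :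 ℤ) * (max (σ' * (mbLo κ Φ t p D (gT mk gx κ Φ t p D) (fT mk fx κ Φ t p D) mk (qY κ Φ t p D (gT mk gx κ Φ t p D) (fT mk fx κ Φ t p D) mk) (NyOf κ Φ t p D (gT mk gx κ Φ t p D) (fT mk fx κ Φ t p D) σ' yY))) (σ' * (mbHi κ Φ t p D (gT mk gx κ Φ t p D) (fT mk fx κ Φ t p D) mk (qY κ Φ t p D (gT mk gx κ Φ t p D) (fT mk fx κ Φ t p D) mk) (NyOf κ Φ t p D (gT mk gx κ Φ t p D) (fT mk fx κ Φ t p D) σ' yY)))) + (shearUnit (nL κ Φ t p D (gT mk gx κ Φ t p D) (fT mk fx κ Φ t p D)) (hL κ Φ t p D (gT mk gx κ Φ t p D) (fT mk fx κ Φ t p D)) : ℤ) - 1))) / (nL κ Φ t p D (gT mk gx κ Φ t p D) (fT mk fx κ Φ t p D) : ℤ))) / (Skelφ.NegPrm.Dof (nL κ Φ t p D (gT mk gx κ Φ t p D) (fT mk fx κ Φ t p D)) (hL κ Φ t p D (gT mk gx κ Φ t p D) (fT mk fx κ Φ t p D)) (ℓL κ Φ t p D (gT mk gx κ Φ t p D)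 (fT mk fx κ Φ t p D)) (vL κ Φ t p D (gT mk gx κ Φ t p D) (fT mk fx κ Φ t p D))) + 1 ≤
        (b0T κ Φ t p D (gT mk gx κ Φ t p D) (fT mk fx κ Φ t p D) 0 : ℤ) - 1 := by
  obtain ⟨hn1, hℓ1⟩ := one_le_of_eqNumL κ Φ t p D _ _ hN
  have hm0 := (Skelφ.NegPrm.modulus_vβOf hn1 (hL κ Φ t p D (gT mk gx κ Φ t p D) (fT mk fx κ Φ t p D)) (ℓL κ Φ t p D (gT mk gx κ Φ t p D) (fT mk fx κ Φ t p D)) (vL κ Φ t p D (gT mk gx κ Φ t p D) (fT mk fx κ Φ t p D))).1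
  have hmℓ := (Skelφ.NegPrm.modulus_vβOf hn1 (hL κ Φ t p D (gT mk gx κ Φ t p D) (fT mk fx κ Φ t p D)) (ℓL κ Φ t p D (gT mk gx κ Φ t p D) (fT mk fx κ Φ t p D)) (vL κ Φ t p D (gT mk gx κ Φ t p D) (fT mk fx κ Φ t p D))).2
  have hm : (nL κ Φ t p D (gT mk gx κ Φ t p D) (fT mk fx κ Φ t p D) : ℤ) * ((ℓL κ Φ t p D (gT mk gx κ Φ t p D) (fT mk fx κ Φ t p D) : ℤ) - 1) < modulus (nL κ Φ t p D (gT mk gx κ Φ t p D) (fT mk fx κ Φ t p D)) (hL κ Φ t p D (gT mk gx κ Φ t p D) (fT mk fx κ Φ t p D)) (vL κ Φ t p D (gT mk gx κ Φ t p D) (fT mk fx κ Φ t p D)) (Skelφ.NegPrm.vβOf (nL κ Φ t p D (gT mk gx κ Φ t p D) (fT mk fx κ Φ t p D)) (hL κ Φ t p D (gT mk gx κ Φ t p D) (fT mk fx κ Φ t p D)) (ℓL κ Φ t p D (gT mk gx κ Φ t p D) (fT mk fx κ Φ t p D)) (vL κ Φ t p D (gT mk gx κ Φ t p D) (fT mk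 fx κ Φ t p D))) := by linarith
  obtain ⟨hc0, hc1, hr0, hr1, hb0, hb1, hu0', hu1⟩ := units_eq κ Φ t p D (gT mk gx κ Φ t p D) (fT mk fx κ Φ t p D)
  have hv : |(vL κ Φ t p D (gT mk gx κ Φ t p D) (fT mk fx κ Φ t p D))| ≤ (nL κ Φ t p D (gT mk gx κ Φ t p D) (fT mk fx κ Φ t p D) : ℤ) := hN.v_le
  have hn : (1 : ℤ) ≤ (nL κ Φ t p D (gT mk gx κ Φ t p D) (fT mk fx κ Φ t p D) : ℤ) := by exact_mod_cast hn1
  have h10 : ((((hL κ Φ t p D (gT mk gx κ Φ t p D) (fT mk fx κ Φ t p D))).natAbs : ℤ)) ≤ 10 * (nL κ Φ t p D (gT mk gx κ Φ t p D) (fT mk fx κ Φ t p D) : ℤ) := by exact_mod_cast hκ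
  have h0' : (0 : ℤ) ≤ ((((hL κ Φ t p D (gT mk gx κ Φ t p D) (fT mk fx κ Φ t p D))).natAbs : ℤ)) := Nat.cast_nonneg _
  have hU : (nL κ Φ t p D (gT mk gx κ Φ t p D) (fT mk fx κ Φ t p D) : ℤ) ≤ (shearUnit (nL κ Φ t p D (gT mk gx κ Φ t p D) (fT mk fx κ Φ t p D)) (hL κ Φ t p D (gT mk gx κ Φ t p D) (fT mk fx κ Φ t p D)) : ℤ) ∧ (shearUnit (nL κ Φ t p D (gT mk gx κ Φ t p D) (fT mk fx κ Φ t p D)) (hL κ Φ t p D (gT mk gx κ Φ t p D) (fT mk fx κ Φ t p D)) : ℤ) ≤ 11 * (nL κ Φ t p D (gT mk gx κ Φ t p D) (fT mk fx κ Φ t p D) : ℤ) := by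
    unfold Skelφ.shearUnit; simp only [Nat.cast_add]; constructor <;> linarith
  have hRA : (0 : ℤ) ≤ (RA' κ Φ t p D mk : ℤ) := Nat.cast_nonneg _
  have hRAn : 2000 * ((RA' κ Φ t p D mk : ℤ) + 2) ≤ (nL κ Φ t p D (gT mk gx κ Φ t p D) (fT mk fx κ Φ t p D) : ℤ) := by
    have := (nL_floorsT κ Φ t p D mk fx (gT mk gx κ Φ t p D)).2.1; exact_mod_cast this
  have hRAℓ : 22000 * ((RA' κ Φ t p D mk : ℤ) + 2) ≤ (ℓL κ Φ t p D (gT mk gx κ Φ t p D) (fT mk fx κ Φ t p D) : ℤ) := by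
    have h1 : ((22000 * (RA' κ Φ t p D mk + 2) : ℕ) : ℤ) ≤ (ML κ Φ t p D (gT mk gx κ Φ t p D) : ℤ) := by exact_mod_cast (ML_floorsT κ Φ t p D mk gx).2.1
    have h2 := hN.ℓ_le
    push_cast at h1; linarith
  obtain ⟨sL, sH, sH', -⟩ := sY_spec κ Φ t p D (gT mk gx κ Φ t p D) (fT mk fx κ Φ t p D) hn1
  have hUpos : (0:ℤ) < (shearUnit (nL κ Φ t p D (gT mk gx κ Φ t p D) (fT mk fx κ Φ t p D)) (hL κ Φ t p D (gT mk gx κ Φ t p D) (fT mk fx κ Φ t p D)) : ℤ) := by linarith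
  have sL' : (shearUnit (nL κ Φ t p D (gT mk gx κ Φ t p D) (fT mk fx κ Φ t p D)) (hL κ Φ t p D (gT mk gx κ Φ t p D) (fT mk fx κ Φ t p D)) : ℤ) * sLoY κ Φ t p D (gT mk gx κ Φ t p D) (fT mk fx κ Φ t p D) ≤ (nL κ Φ t p D (gT mk gx κ Φ t p D) (fT mk fx κ Φ t p D) : ℤ) * (ℓL κ Φ t p D (gT mk gx κ Φ t p D) (fT mk fx κ Φ t p D) : ℤ) - (shearUnit (nL κ Φ t p D (gT mk gx κ Φ t p D) (fT mk fx κ Φ t p D)) (hL κ Φ t p D (gT mk gx κ Φ t p D) (fT mk fx κ Φ t p D)) : ℤ) + 1 := by unfold sLoY; exact Int.mul_ediv_self_le hUpos.ne'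
  have hUqY : (shearUnit (nL κ Φ t p D (gT mk gx κ Φ t p D) (fT mk fx κ Φ t p D)) (hL κ Φ t p D (gT mk gx κ Φ t p D) (fT mk fx κ Φ t p D)) : ℤ) * ((qY κ Φ t p D (gT mk gx κ Φ t p D) (fT mk fx κ Φ t p D) mk) : ℤ) ≤ (nL κ Φ t p D (gT mk gx κ Φ t p D) (fT mk fx κ Φ t p D) : ℤ) * (ℓL κ Φ t p D (gT mk gx κ Φ t p D) (fT mk fx κ Φ t p D) : ℤ) + (shearUnit (nL κ Φ t p D (gT mk gx κ Φ t p D) (fT mk fx κ Φ t p D)) (hL κ Φ t p D (gT mk gx κ Φ t p D) (fT mk fx κ Φ t p D)) : ℤ) * (4 * (RA' κ Φ t p D mk : ℤ) + 4) := by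
    unfold qY; push_cast
    have hW := (Wrun_spec κ Φ t p D (gT mk gx κ Φ t p D) (fT mk fx κ Φ t p D) hn1).1
    nlinarith [hU.1]
  obtain ⟨hN', -⟩ := NyOf_spec κ Φ t p D (gT mk gx κ Φ t p D) (fT mk fx κ Φ t p D) hN hσ' yY hΛ₁3
  have hN1 : ((NyOf κ Φ t p D (gT mk gx κ Φ t p D) (fT mk fx κ Φ t p D) σ' yY) : ℤ) + 1 ≤ 1000 := by
    have h' : ((0 + 1 + 3 + 1 + NyOf κ Φ t p D (gT mk gx κ Φ t p D) (fT mk fx κ Φ t p D) σ' yY : ℕ) : ℤ) ≤ 1000 := by exact_mod_cast hN'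
    push_cast at h'; linarith
  have hN0 : (0 : ℤ) ≤ ((NyOf κ Φ t p D (gT mk gx κ Φ t p D) (fT mk fx κ Φ t p D) σ' yY) : ℤ) := Nat.cast_nonneg _
  obtain ⟨hv1, hv2⟩ := abs_le.1 hv
  have ha1 : (((((nL κ Φ t p D (gT mk gx κ Φ t p D) (fT mk fx κ Φ t p D) : ℤ)) + (vL κ Φ t p D (gT mk gx κ Φ t p D) (fT mk fx κ Φ t p D))).toNat : ℤ)) = (nL κ Φ t p D (gT mk gx κ Φ t p D) (fT mk fx κ Φ t p D) : ℤ) + (vL κ Φ t p D (gT mk gx κ Φ t p D) (fT mk fx κ Φ t p D)) := Int.toNat_of_nonneg (by linarith)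
  have ha2 : (((((nL κ Φ t p D (gT mk gx κ Φ t p D) (fT mk fx κ Φ t p D) : ℤ)) - (vL κ Φ t p D (gT mk gx κ Φ t p D) (fT mk fx κ Φ t p D))).toNat : ℤ)) = (nL κ Φ t p D (gT mk gx κ Φ t p D) (fT mk fx κ Φ t p D) : ℤ) - (vL κ Φ t p D (gT mk gx κ Φ t p D) (fT mk fx κ Φ t p D)) := Int.toNat_of_nonneg (by linarith)
  have hu17 : 17 ≤ u₀ κ Φ t p D (gT mk gx κ Φ t p D) (fT mk fx κ Φ t p D) := by
    obtain ⟨hs0, -⟩ := cells_geT κ Φ t p D mk gx (fT mk fx κ Φ t p D) hN hκ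
    have hq : (1 : ℤ) ≤ Neg.Kq κ := by exact_mod_cast Neg.one_le_Kq κ
    have hR1 : (1 : ℤ) ≤ (RA' κ Φ t p D mk : ℤ) := by have := (RA'_eq κ Φ t p D mk).1; exact_mod_cast (by omega : 1 ≤ RA' κ Φ t p D mk)
    have h17 := mul_le_mul hq (show (17:ℤ) ≤ ((((fcells κ Φ t p D (gT mk gx κ Φ t p D) (fT mk fx κ Φ t p D)).s 0 : ℕ) : ℤ)) by linarith) (by norm_num) (by linarith)
    unfold u₀; linarith
  have hq0 : (0:ℤ) ≤ ((qY κ Φ t p D (gT mk gx κ Φ t p D) (fT mk fx κ Φ t p D) mk) : ℤ) := Nat.cast_nonneg _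
  -- put the goal in the RootArith shape and replace the atoms by variables
  unfold TwoAxis.Para.coarse
  rw [hc0, Dof_eq', (lam_eq κ Φ t p D (gT mk gx κ Φ t p D) (fT mk fx κ Φ t p D) yY).1]
  have e1 : -((b0T κ Φ t p D (gT mk gx κ Φ t p D) (fT mk fx κ Φ t p D) 0 : ℤ) - 1) = -(10 * u₀ κ Φ t p D (gT mk gx κ Φ t p D) (fT mk fx κ Φ t p D) - 1) := by rw [hb0]
  have e2 : (b0T κ Φ t p D (gT mk gx κ Φ t p D) (fT mk fx κ Φ t p D) 0 : ℤ) - 1 = 10 * u₀ κ Φ t p D (gT mk gx κ Φ t p D) (fT mk fx κ Φ t p D) - 1 := by rw [hb0]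
  rw [e1, e2]
  unfold mbLo mbHi maLo maHi
  rw [ha1, ha2]
  generalize ((NyOf κ Φ t p D (gT mk gx κ Φ t p D) (fT mk fx κ Φ t p D) σ' yY) : ℤ) = N at hN1 hN0 ⊢
  generalize u₀ κ Φ t p D (gT mk gx κ Φ t p D) (fT mk fx κ Φ t p D) = u at hu17 ⊢
  generalize Λ₀of κ Φ t p D (gT mk gx κ Φ t p D) (fT mk fx κ Φ t p D) yY = Λ at hrel ⊢
  generalize Λ₀of κ Φ t p D (gT mk gx κ Φ t p D) (fT mk fx κ Φ t p D) yX = Λx at hrel hΛ₀ ⊢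
  generalize modulus (nL κ Φ t p D (gT mk gx κ Φ t p D) (fT mk fx κ Φ t p D)) (hL κ Φ t p D (gT mk gx κ Φ t p D) (fT mk fx κ Φ t p D)) (vL κ Φ t p D (gT mk gx κ Φ t p D) (fT mk fx κ Φ t p D)) (Skelφ.NegPrm.vβOf (nL κ Φ t p D (gT mk gx κ Φ t p D) (fT mk fx κ Φ t p D)) (hL κ Φ t p D (gT mk gx κ Φ t p D) (fT mk fx κ Φ t p D)) (ℓL κ Φ t p D (gT mk gx κ Φ t p D) (fT mk fx κ Φ t p D)) (vL κ Φ t p D (gT mk gx κ Φ t p D) (fT mk fx κ Φ t p D))) = M at hm hmℓ hrel hΛ₀ ⊢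
  generalize ((qY κ Φ t p D (gT mk gx κ Φ t p D) (fT mk fx κ Φ t p D) mk) : ℤ) = Q at hUqY hq0 ⊢
  generalize sLoY κ Φ t p D (gT mk gx κ Φ t p D) (fT mk fx κ Φ t p D) = sl at sL sL' ⊢
  generalize sHiY κ Φ t p D (gT mk gx κ Φ t p D) (fT mk fx κ Φ t p D) = sh at sH sH' ⊢
  generalize (shearUnit (nL κ Φ t p D (gT mk gx κ Φ t p D) (fT mk fx κ Φ t p D)) (hL κ Φ t p D (gT mk gx κ Φ t p D) (fT mk fx κ Φ t p D)) : ℤ) = Uz at hU hUpos sL sL' sH sH' hUqY ⊢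
  generalize (vL κ Φ t p D (gT mk gx κ Φ t p D) (fT mk fx κ Φ t p D)) = v at hv hv1 hv2 hrel ⊢
  generalize (RA' κ Φ t p D mk : ℤ) = R at hRA hRAn hRAℓ hUqY ⊢
  generalize (nL κ Φ t p D (gT mk gx κ Φ t p D) (fT mk fx κ Φ t p D) : ℤ) = n at hn hm hmℓ hU hRAn sL sL' sH sH' hUqY hv hv1 hv2 hrel hρ1' ⊢
  generalize (ℓL κ Φ t p D (gT mk gx κ Φ t p D) (fT mk fx κ Φ t p D) : ℤ) = ℓ at hm hmℓ hRAℓ sL sL' sH sH' hUqY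
  -- the windows
  have haL : (N + 1) * v - v - (n + (N + 1) * R) ≤ (N + 1) * v - (n + v + (N + 1) * R) := by linarith
  have haH : (N + 1) * v + (n - v + (N + 1) * R) ≤ (N + 1) * v - v + (n + (N + 1) * R) := by linarith
  have hNR : 0 ≤ (N + 1) * R := mul_nonneg (by linarith) hRA
  have haLH : (N + 1) * v - (n + v + (N + 1) * R) ≤ (N + 1) * v + (n - v + (N + 1) * R) := by linarith
  have e1 := mul_le_mul_of_nonneg_left sL (by linarith : (0:ℤ) ≤ N + 1)
  have e2 := mul_le_mul_of_nonneg_left hmℓ (by linarith : (0:ℤ) ≤ N + 1)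
  have e3 := mul_le_mul_of_nonneg_left sH (by linarith : (0:ℤ) ≤ N + 1)
  have e4 := mul_le_mul_of_nonneg_left (show n * ℓ ≤ M + n by linarith) (by linarith : (0:ℤ) ≤ N + 1)
  have hNn : (0:ℤ) ≤ (N + 1) * n := mul_nonneg (by linarith) (by linarith)
  have hNU : (0:ℤ) ≤ (N + 1) * Uz := mul_nonneg (by linarith) hUpos.le
  have hbL : (N + 1) * M - ((N + 1) * (n + 2 * Uz) + Uz * Q + (N + 1) * (Uz * R) + Uz) ≤ Uz * ((N + 1) * sl - Q - (N + 1) * R) - Uz := by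
    have : Uz * ((N + 1) * sl - Q - (N + 1) * R) = (N + 1) * (Uz * sl) - Uz * Q - (N + 1) * (Uz * R) := by ring
    rw [this]; linarith
  have hbH : Uz * ((N + 1) * sh + Q + (N + 1) * R) + Uz - 1 ≤ (N + 1) * M + ((N + 1) * (n + 2 * Uz) + Uz * Q + (N + 1) * (Uz * R) + Uz) := by
    have : Uz * ((N + 1) * sh + Q + (N + 1) * R) = (N + 1) * (Uz * sh) + Uz * Q + (N + 1) * (Uz * R) := by ring
    rw [this]; linarith
  have hss : sl < sh := by
    by_contra hc; push Not at hc
    have := mul_le_mul_of_nonneg_left hc hUpos.le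
    linarith
  have hbLH : (N + 1) * sl - Q - (N + 1) * R ≤ (N + 1) * sh + Q + (N + 1) * R := by
    have := mul_le_mul_of_nonneg_left hss.le (by linarith : (0:ℤ) ≤ N + 1)
    linarith
  have hrβ0 : (0:ℤ) ≤ (N + 1) * (n + 2 * Uz) + Uz * Q + (N + 1) * (Uz * R) + Uz := by
    have a1 : (0:ℤ) ≤ (N + 1) * (n + 2 * Uz) := mul_nonneg (by linarith) (by linarith)
    have a2 : (0:ℤ) ≤ Uz * Q := mul_nonneg hUpos.le hq0
    have a3 : (0:ℤ) ≤ (N + 1) * (Uz * R) := mul_nonneg (by linarith) (mul_nonneg hUpos.le hRA)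
    linarith
  have hrβ' : (N + 1) * (n + 2 * Uz) + Uz * Q + (N + 1) * (Uz * R) + Uz ≤ 2 * M + 3 * n := by
    have t1 : (N + 1) * (n + 2 * Uz) ≤ 1000 * (23 * n) := mul_le_mul hN1 (by linarith [hU.2]) (by linarith [hU.1]) (by norm_num)
    have t2 : (N + 1) * (Uz * R) ≤ 1000 * (11 * n * R) := mul_le_mul hN1 (mul_le_mul_of_nonneg_right hU.2 hRA) (mul_nonneg hUpos.le hRA) (by norm_num)
    have t3 : Uz * (4 * R + 4) ≤ 11 * n * (4 * R + 4) := mul_le_mul_of_nonneg_right hU.2 (by linarith)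
    have t4 : n * (22000 * (R + 2)) ≤ n * ℓ := mul_le_mul_of_nonneg_left hRAℓ (by linarith)
    have t5 : (0:ℤ) ≤ n * R := mul_nonneg (by linarith) hRA
    linarith [hU.2]
  exact RootArith.transY_last hu17 hn hm hU.1 hU.2 hv hRA hRAn hRAℓ hN1 hσ' hσu haL haLH haH hbL hbLH hbH hrβ0 hrβ' hrel hρ0 hρ1' hΛ₀

end AtT

end KS

end NegB

end PlanarSkeletonNeg

end Summit.CriticalPhenomena.PercolationContinuityZ3.Theorems.Transplant
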